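import Literature.Computability.Cryptography.WordRAMRegLoops
import Literature.Computability.Cryptography.FGProblemZoo
import Literature.Computability.Cryptography.FloydWarshall
import Mathlib.Tactic.IntervalCases
import HarnessLib

/-!
# Floyd's Algorithm 97 on the word RAM

A verified implementation of R. W. Floyd's *Algorithm 97* (all-pairs shortest paths by the
in-place triple loop, Comm. ACM 5 (1962) 345) as a concrete program `apspProgram` (193
instructions) of the word RAM of `Literature.Computability.Cryptography.WordRAM`, in the
input/output format of the fine-grained problem `APSP c` (`…FGProblemZoo`: the word `n`, then
the `n²` entries of the weight matrix row-major, `⊤ ↦ 0`, `z ↦ zigzag z + 1`; output the matrix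
`shortestDist W` in the same format), together with the theorem `apsp_run`: on an `n`-vertex
weight matrix `W` without negative cycles and with weights in `[-M, M]`, run with a word size `w`
with `inputWidth + 3 ≤ w`, `16 n M ≤ 2 ^ w`, `2 n² + 32 ≤ 2 ^ w`, `n³ < 2 ^ w`, the program halts
after exactly `apspSteps n ≤ 32 n³ + 59 n² + 112` steps with output
`encodeMatrixWithTop (shortestDist W)`. This is the machine-level half of the `O(n³)` bound;
the mathematical half (the in-place loop computes `shortestDist`) is `fwInPlace_end` /
`floydWarshall_eq_shortestDist` of `…FloydWarshall`. The last section assembles the two into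
`APSP_inTimeO_cube_holds`, the discharge of the named fact `APSP_inTimeO_cube` of
`…FGProblemZoo`: for every weight exponent `c`, `APSP c` (weights in `[-nᶜ, nᶜ]`, no negative
cycle) is solved by `apspProgram` within `203 n³ + 203` steps at word size
`(c + 7) · inputWidth` (the word then holds the bias `B = 2 ^ (w - 3) ≥ 2 n · nᶜ`, the addresses
`≤ 2 n² + 32` and the loop counter `< n³`; `203` bounds `32 n³ + 59 n² + 112`).

## The program

Memory cells `0, …, 15` serve as registers (`rP, rN, rQ, …`); the input occupies cells
`0, …, n² + 1` (`mem 0 = n² + 1`, `mem 1 = n`, entry `q = i n + j` at cell `q + 2`), so the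
program first moves the matrix out of the register area to `BASE + q`, `BASE = n² + 16`:

* prologue (`prologueSave`, `prologueRegs`, 47 operations): save the input words in cells
  `2, …, 15` to `BASE, …, BASE + 13`; `BASE := n² + 16`, `NN := n²`, `LIM := n²`, `Q := 14`;
* loop 1 (`copyUpBody`): `cell (BASE + Q) := cell (Q + 2)` for `Q = 14, …, n² - 1`;
* `setupBias`: `B := 2 ^ (w - 3)` (computed as `(0 - 1) / 8 + 1`), `INF := 3 B`, `Q := 0`;
* loop 2 (`decodeBody`): replace each input code by the *biased word* of its weight
  (`encB`: `⊤ ↦ 3 B`, `z ↦ B + z`), capping the diagonal at `B` (the code of `0`: the recurrence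
  starts from `D⁽⁰⁾ = fwInit W` whose diagonal is `min (W i i) 0`);
* `setupCube`; loop 3 (`relaxBody`, `n³` iterations, counter `Q = k n² + i n + j`): Floyd's
  statement `if m[i,k], m[k,j] finite then m[i,j] := min (m[i,j], m[i,k] + m[k,j])` on biased
  words (`relaxOut`), branch-free;
* `setupSquare`; loop 4 (`encodeBody`): replace each biased word by the output code
  (`encodeOut`);
* `setupCopyDown`; loop 5 (`copyDownBody`): `cell (Q + 2) := cell (BASE + Q)` for
  `Q = 14, …, n² - 1`;
* epilogue (`restoreOps`, `epilogueLen`, 44 operations): cells `2, …, 15 := BASE, …, BASE + 13`,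
  `mem 0 := n² + 1`; `halt`.

All loops are `forLoop`s of `…WordRAMRegLoops` (`T := (Q < LIM); jz T EXIT; body; Q := Q + 1;
jmp L`).

## The proof

* Symbolic execution of each loop body on a register file `regMem [16 registers] heap`
  (`copyUp_iter`, `decode_iter`, `relax_iter`, `encode_iter`, `copyDown_iter`), by `simp` with
  the read/write lemmas of `regMem` and side computations of the modular arithmetic;
* the loop phases by induction along the iterations (`copyUp_phase`, `decode_phase`,
  `relax_phase`, `encode_phase`, `copyDown_phase`), with the heap after `t` iterations given
  in closed form (`heapCU`, `heapDec`, `heapRel`/`relaxSeq`, `heapEnc`, `heapCD`);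
* the straight-line prologue/epilogue operation by operation on plain memories
  (`execOps_saveOps`, `execOps_restoreOps`, `execOps_prologue`, `execOps_epilogue`);
* the arithmetic of biased words (`relaxOut_encB`: relaxation of biased words is
  `min z (x + y)` on weights; `decodeOut_encode`, `encodeOut_encB`: decoding/encoding are
  inverse to the zoo's `encodeWithTopInt` up to the bias), valid while all weights stay in
  `[-B/2, B/2]`, which `hasBoundedWeights_fwInPlace` (`|entries| ≤ n M`) and `16 n M ≤ 2 ^ w`
  guarantee; hence `relaxSeq_eq_encB`: after `t` iterations loop 3 holds `fwInPlace W t` in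
  biased words;
* assembly of the eleven run segments (`apsp_run`) with `run_add_of_run`, and identification of
  the output list with `encodeMatrixWithTop (shortestDist W)` entry by entry
  (`encodeMatrixWithTop_getElem?`, `heap₄_apply`).

## References

* R. W. Floyd, *Algorithm 97: Shortest path*, Comm. ACM 5 (6) (1962), p. 345.
  doi:10.1145/367766.368168
* T. H. Cormen, C. E. Leiserson, R. L. Rivest, C. Stein, *Introduction to Algorithms*, 3rd ed.
  (2009), §25.2 (`FLOYD-WARSHALL` runs in `Θ(n³)` time; Exercise 25.2-4, the in-place version).
* T. Hagerup, *Sorting and searching on the word RAM*, STACS 1998, §2 (the machine model).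
-/

namespace Literature.Computability.Cryptography.WordRAM

open StateTransition

namespace APSPProg

/-! ## Registers (memory cells `0, …, 15`) -/

/-- Pointer scratch register (prologue/epilogue). [folklore] -/
abbrev rP : ℕ := 0
/-- Holds `n` throughout (it is input word `0`). [folklore] -/
abbrev rN : ℕ := 1
/-- Loop counter. [folklore] -/
abbrev rQ : ℕ := 2
/-- Loop limit. [folklore] -/
abbrev rLIM : ℕ := 3
/-- Loop flag. [folklore] -/
abbrev rT : ℕ := 4
/-- Base address of the working matrix (`n² + 16`). [folklore] -/
abbrev rBASE : ℕ := 5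
/-- The bias `B = 2 ^ (w - 3)`. [folklore] -/
abbrev rB : ℕ := 6
/-- The code of `⊤`, `3 B`. [folklore] -/
abbrev rINF : ℕ := 7
/-- Holds `n²`. [folklore] -/
abbrev rNN : ℕ := 8
/-- Temporaries. [folklore] -/
abbrev rX : ℕ := 9
/-- Temporary register. [folklore] -/
abbrev rY : ℕ := 10
/-- Temporary register. [folklore] -/
abbrev rZ : ℕ := 11
/-- Temporary register (the value about to be stored). [folklore] -/
abbrev rS : ℕ := 12
/-- Temporary register. [folklore] -/
abbrev rU : ℕ := 13
/-- Temporary register. [folklore] -/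
abbrev rV : ℕ := 14
/-- Address register for indirect loads and stores. [folklore] -/
abbrev rA : ℕ := 15

open Operand BinOp

/-- `dst := o x y` on registers/operands. [folklore] -/
abbrev mk (o : BinOp) (d x y : Operand) : OpSpec := (o, d, x, y)

/-! ## The straight-line segments -/

/-- `saveOps m`: save the input words in cells `2, …, 2 + m - 1` (which become registers) to
`n² + 16, n² + 17, …` (the base of the working matrix): for each `l < m`,
`P := n * n; P := P + (16 + l); [P] := cell (2 + l)`. [folklore] -/
def saveOps : ℕ → List OpSpec
  | 0 => []
  | m + 1 => saveOps m ++
      [mk mul (dir rP) (dir rN) (dir rN), mk add (dir rP) (dir rP) (imm (16 + m)),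
       mk add (ind rP) (dir (2 + m)) (imm 0)]

/-- Prologue, part 1: save cells `2, …, 15` to `BASE, …, BASE + 13`. [folklore] -/
def prologueSave : List OpSpec :=
  saveOps 14

/-- Prologue, part 2: `BASE := n * n + 16; NN := n * n; LIM := NN; Q := 14`. [folklore] -/
def prologueRegs : List OpSpec :=
  [mk mul (dir rBASE) (dir rN) (dir rN), mk add (dir rBASE) (dir rBASE) (imm 16),
   mk mul (dir rNN) (dir rN) (dir rN), mk add (dir rLIM) (dir rNN) (imm 0),
   mk add (dir rQ) (imm 14) (imm 0)]

/-- Copy-up loop body: `cell (BASE + Q) := cell (Q + 2)`. [folklore] -/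
def copyUpBody : List OpSpec :=
  [mk add (dir rA) (dir rQ) (imm 2), mk add (dir rX) (dir rBASE) (dir rQ),
   mk add (ind rX) (ind rA) (imm 0)]

/-- Between copy-up and decode: `B := (0 - 1) / 8 + 1 = 2 ^ (w - 3)`, `INF := 3 B`, `Q := 0`.
[folklore] -/
def setupBias : List OpSpec :=
  [mk sub (dir rB) (imm 0) (imm 1), mk div (dir rB) (dir rB) (imm 8),
   mk add (dir rB) (dir rB) (imm 1),
   mk mul (dir rINF) (dir rB) (imm 3), mk add (dir rQ) (imm 0) (imm 0)]

/-- Decode loop body: replace the input code `e` of entry `Q` (`0` for `⊤`, `zigzag z + 1` for `z`)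
by its biased representation (`3 B` for `⊤`, `B + z` for `z`), and on the diagonal take the
minimum with `B` (the code of `0`). [cite: FloydCACM1962, Algorithm 97] -/
def decodeBody : List OpSpec :=
  [mk add (dir rA) (dir rBASE) (dir rQ),      -- A := BASE + Q
   mk add (dir rX) (ind rA) (imm 0),          -- X := [A]            (e)
   mk div (dir rY) (dir rX) (imm 2),          -- Y := e / 2          (h)
   mk mod (dir rZ) (dir rX) (imm 2),          -- Z := e % 2          (par)
   mk sub (dir rS) (dir rB) (dir rY),         -- S := B - h
   mk mul (dir rU) (dir rY) (dir rZ),         -- U := h * par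
   mk add (dir rU) (dir rU) (dir rU),         -- U := 2 h par
   mk add (dir rS) (dir rS) (dir rU),         -- S := B - h + 2 h par
   mk eq (dir rU) (dir rX) (imm 0),           -- U := (e = 0)
   mk mul (dir rU) (dir rU) (dir rB),         -- U := (e = 0) B
   mk add (dir rU) (dir rU) (dir rU),         -- U := 2 (e = 0) B
   mk add (dir rS) (dir rS) (dir rU),         -- S := S + U         (3 B if e = 0)
   mk div (dir rU) (dir rQ) (dir rN),         -- U := Q / n          (i)
   mk mod (dir rV) (dir rQ) (dir rN),         -- V := Q % n          (j)
   mk eq (dir rU) (dir rU) (dir rV),          -- U := (i = j)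
   mk lt (dir rV) (dir rB) (dir rS),          -- V := (B < S)
   mk mul (dir rV) (dir rV) (dir rU),         -- V := (B < S) (i = j)
   mk sub (dir rY) (dir rS) (dir rB),         -- Y := S - B
   mk mul (dir rY) (dir rY) (dir rV),         -- Y := (S - B) V
   mk sub (dir rS) (dir rS) (dir rY),         -- S := S - Y
   mk add (ind rA) (dir rS) (imm 0)]          -- [A] := S

/-- Between decode and relax: `LIM := NN * n = n³`, `Q := 0`. [folklore] -/
def setupCube : List OpSpec :=
  [mk mul (dir rLIM) (dir rNN) (dir rN), mk add (dir rQ) (imm 0) (imm 0)]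

/-- The relaxation body (Floyd's inner statement, in place, on biased values): with `k = Q / n²`,
`p = Q % n²`, `i = p / n`, `j = p % n`, `x = m[i,k]`, `y = m[k,j]`, `z = m[i,j]`:
`m[i,j] := if x = INF ∨ y = INF then z else min (x + y - B) z`.
[cite: FloydCACM1962, Algorithm 97] -/
def relaxBody : List OpSpec :=
  [mk div (dir rX) (dir rQ) (dir rNN),        -- X := k
   mk mod (dir rY) (dir rQ) (dir rNN),        -- Y := p
   mk div (dir rZ) (dir rY) (dir rN),         -- Z := i
   mk mod (dir rS) (dir rY) (dir rN),         -- S := j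
   mk mul (dir rA) (dir rZ) (dir rN),         -- A := i n
   mk add (dir rA) (dir rA) (dir rX),         -- A := i n + k
   mk add (dir rA) (dir rA) (dir rBASE),      -- A := i n + k + BASE
   mk add (dir rU) (ind rA) (imm 0),          -- U := x
   mk mul (dir rA) (dir rX) (dir rN),         -- A := k n
   mk add (dir rA) (dir rA) (dir rS),         -- A := k n + j
   mk add (dir rA) (dir rA) (dir rBASE),      -- A := k n + j + BASE
   mk add (dir rV) (ind rA) (imm 0),          -- V := y
   mk add (dir rA) (dir rY) (dir rBASE),      -- A := p + BASE
   mk add (dir rZ) (ind rA) (imm 0),          -- Z := z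
   mk add (dir rS) (dir rU) (dir rV),         -- S := x + y
   mk sub (dir rS) (dir rS) (dir rB),         -- S := x + y - B      (cand)
   mk lt (dir rX) (dir rS) (dir rZ),          -- X := (cand < z)
   mk sub (dir rX) (imm 1) (dir rX),          -- X := 1 - X
   mk sub (dir rY) (dir rZ) (dir rS),         -- Y := z - cand       (mod 2^w)
   mk mul (dir rY) (dir rY) (dir rX),         -- Y := Y X
   mk add (dir rS) (dir rS) (dir rY),         -- S := min cand z
   mk eq (dir rX) (dir rU) (dir rINF),        -- X := (x = INF)
   mk eq (dir rY) (dir rV) (dir rINF),        -- Y := (y = INF)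
   mk bor (dir rX) (dir rX) (dir rY),         -- X := X or Y
   mk sub (dir rY) (dir rZ) (dir rS),         -- Y := z - S          (mod 2^w)
   mk mul (dir rY) (dir rY) (dir rX),         -- Y := Y X
   mk add (dir rS) (dir rS) (dir rY),         -- S := final
   mk add (ind rA) (dir rS) (imm 0)]          -- [A] := S

/-- Between relax and encode: `LIM := NN`, `Q := 0`. [folklore] -/
def setupSquare : List OpSpec :=
  [mk add (dir rLIM) (dir rNN) (imm 0), mk add (dir rQ) (imm 0) (imm 0)]

/-- Encode loop body: replace the biased value `b` of entry `Q` by its output code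
(`0` for `INF`, `2 (b - B) + 1` if `B ≤ b`, `2 (B - b)` if `b < B`).
[cite: FloydCACM1962, Algorithm 97] -/
def encodeBody : List OpSpec :=
  [mk add (dir rA) (dir rBASE) (dir rQ),      -- A := BASE + Q
   mk add (dir rX) (ind rA) (imm 0),          -- X := b
   mk lt (dir rY) (dir rX) (dir rB),          -- Y := (b < B)
   mk sub (dir rZ) (imm 1) (dir rY),          -- Z := 1 - Y
   mk sub (dir rS) (dir rX) (dir rB),         -- S := b - B          (mod 2^w)
   mk add (dir rS) (dir rS) (dir rS),         -- S := 2 (b - B)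
   mk add (dir rS) (dir rS) (imm 1),          -- S := 2 (b - B) + 1
   mk mul (dir rS) (dir rS) (dir rZ),         -- S := S (B ≤ b)
   mk sub (dir rU) (dir rB) (dir rX),         -- U := B - b          (mod 2^w)
   mk add (dir rU) (dir rU) (dir rU),         -- U := 2 (B - b)
   mk mul (dir rU) (dir rU) (dir rY),         -- U := U (b < B)
   mk add (dir rS) (dir rS) (dir rU),         -- S := S + U
   mk eq (dir rY) (dir rX) (dir rINF),        -- Y := (b = INF)
   mk sub (dir rY) (imm 1) (dir rY),          -- Y := 1 - Y
   mk mul (dir rS) (dir rS) (dir rY),         -- S := S (b ≠ INF)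
   mk add (ind rA) (dir rS) (imm 0)]          -- [A] := S

/-- Between encode and copy-down: `Q := 14`. [folklore] -/
def setupCopyDown : List OpSpec :=
  [mk add (dir rQ) (imm 14) (imm 0)]

/-- Copy-down loop body: `cell (Q + 2) := cell (BASE + Q)`. [folklore] -/
def copyDownBody : List OpSpec :=
  [mk add (dir rA) (dir rBASE) (dir rQ), mk add (dir rX) (dir rQ) (imm 2),
   mk add (ind rX) (ind rA) (imm 0)]

/-- `restoreOps m`: copy the words at `n² + 16, n² + 17, …` back to cells `2, …, 2 + m - 1`:
for each `l < m`, `P := n * n; P := P + (16 + l); cell (2 + l) := [P]`. [folklore] -/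
def restoreOps : ℕ → List OpSpec
  | 0 => []
  | m + 1 => restoreOps m ++
      [mk mul (dir rP) (dir rN) (dir rN), mk add (dir rP) (dir rP) (imm (16 + m)),
       mk add (dir (2 + m)) (ind rP) (imm 0)]

/-- Epilogue, last part: `P := n * n + 1` (the output length); followed by `halt`. [folklore] -/
def epilogueLen : List OpSpec :=
  [mk mul (dir rP) (dir rN) (dir rN), mk add (dir rP) (dir rP) (imm 1)]

/-- Epilogue: restore cells `2, …, 15` from `BASE, …, BASE + 13`; `P := n * n + 1`. [folklore] -/
def epilogue : List OpSpec :=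
  restoreOps 14 ++ epilogueLen

/-! ## Labels and the program -/

/-- Head of the copy-up loop (end of the prologue). [folklore] -/
abbrev L1 : ℕ := 47
/-- Exit of the copy-up loop = start of `setupBias`. [folklore] -/
abbrev E1 : ℕ := 54
/-- Head of the decode loop. [folklore] -/
abbrev L2 : ℕ := 59
/-- Exit of the decode loop = start of `setupCube`. [folklore] -/
abbrev E2 : ℕ := 84
/-- Head of the relaxation loop. [folklore] -/
abbrev L3 : ℕ := 86
/-- Exit of the relaxation loop = start of `setupSquare`. [folklore] -/
abbrev E3 : ℕ := 118
/-- Head of the encode loop. [folklore] -/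
abbrev L4 : ℕ := 120
/-- Exit of the encode loop = start of `setupCopyDown`. [folklore] -/
abbrev E4 : ℕ := 140
/-- Head of the copy-down loop. [folklore] -/
abbrev L5 : ℕ := 141
/-- Exit of the copy-down loop = start of the epilogue. [folklore] -/
abbrev E5 : ℕ := 148
/-- Position of the final `halt`. [folklore] -/
abbrev HALT : ℕ := 192

/-- Straight-line code as instructions. [folklore] -/
abbrev ops (l : List OpSpec) : List Instr := l.map OpSpec.toInstr

end APSPProg

open APSPProg in
/-- **Floyd's Algorithm 97 as a word-RAM program** (193 instructions).
[cite: FloydCACM1962, Algorithm 97] -/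
def apspProgram : Program :=
  ops (prologueSave ++ prologueRegs) ++
  forLoop rT rQ rLIM L1 E1 copyUpBody ++
  ops setupBias ++
  forLoop rT rQ rLIM L2 E2 decodeBody ++
  ops setupCube ++
  forLoop rT rQ rLIM L3 E3 relaxBody ++
  ops setupSquare ++
  forLoop rT rQ rLIM L4 E4 encodeBody ++
  ops setupCopyDown ++
  forLoop rT rQ rLIM L5 E5 copyDownBody ++
  ops epilogue ++
  [.halt]

namespace APSPProg

/-- The program has `193` instructions. [folklore] -/
theorem apspProgram_length : apspProgram.length = 193 := by decide +kernel

/-- The program uses no coins. [folklore] -/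
theorem isDeterministic : apspProgram.IsDeterministic := by decide +kernel
/-- The program makes no oracle queries. [folklore] -/
theorem isOracleFree : apspProgram.IsOracleFree := by decide +kernel

/-- Placement of the prologue. [folklore] -/
theorem code_prologue :
    CodeAt apspProgram 0 (ops (prologueSave ++ prologueRegs)) :=
  codeAt_of_codeAtB (by decide +kernel)
/-- Placement of the copy-up loop. [folklore] -/
theorem code_loop1 : CodeAt apspProgram L1 (forLoop rT rQ rLIM L1 E1 copyUpBody) :=
  codeAt_of_codeAtB (by decide +kernel)
/-- Placement of `setupBias`. [folklore] -/
theorem code_setupBias : CodeAt apspProgram E1 (ops setupBias) :=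
  codeAt_of_codeAtB (by decide +kernel)
/-- Placement of the decode loop. [folklore] -/
theorem code_loop2 : CodeAt apspProgram L2 (forLoop rT rQ rLIM L2 E2 decodeBody) :=
  codeAt_of_codeAtB (by decide +kernel)
/-- Placement of `setupCube`. [folklore] -/
theorem code_setupCube : CodeAt apspProgram E2 (ops setupCube) :=
  codeAt_of_codeAtB (by decide +kernel)
/-- Placement of the relaxation loop. [folklore] -/
theorem code_loop3 : CodeAt apspProgram L3 (forLoop rT rQ rLIM L3 E3 relaxBody) :=
  codeAt_of_codeAtB (by decide +kernel)
/-- Placement of `setupSquare`. [folklore] -/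
theorem code_setupSquare : CodeAt apspProgram E3 (ops setupSquare) :=
  codeAt_of_codeAtB (by decide +kernel)
/-- Placement of the encode loop. [folklore] -/
theorem code_loop4 : CodeAt apspProgram L4 (forLoop rT rQ rLIM L4 E4 encodeBody) :=
  codeAt_of_codeAtB (by decide +kernel)
/-- Placement of `setupCopyDown`. [folklore] -/
theorem code_setupCopyDown : CodeAt apspProgram E4 (ops setupCopyDown) :=
  codeAt_of_codeAtB (by decide +kernel)
/-- Placement of the copy-down loop. [folklore] -/
theorem code_loop5 : CodeAt apspProgram L5 (forLoop rT rQ rLIM L5 E5 copyDownBody) :=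
  codeAt_of_codeAtB (by decide +kernel)
/-- Placement of the epilogue. [folklore] -/
theorem code_epilogue : CodeAt apspProgram E5 (ops epilogue) :=
  codeAt_of_codeAtB (by decide +kernel)
/-- Placement of the final `halt`. [folklore] -/
theorem code_halt : apspProgram[HALT]? = some .halt := by decide +kernel

/-! ## Symbolic execution of the loop bodies -/

section bodies

variable {w : ℕ}

attribute [local simp] rP rN rQ rLIM rT rBASE rB rINF rNN rX rY rZ rS rU rV rA

/-- One iteration of the copy-up loop. [folklore] -/
theorem copyUp_iter {p n q lim tt base r6 r7 nn r9 r10 r11 r12 r13 r14 r15 : ℕ}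
    {heap : ℕ → ℕ} (hq : 14 ≤ q) (hqw : q + 2 < 2 ^ w) (hbq : base + q < 2 ^ w) (hb : 16 ≤ base)
    (hv : heap (q + 2) < 2 ^ w) :
    forStep w rT rQ copyUpBody
        (regMem [p, n, q, lim, tt, base, r6, r7, nn, r9, r10, r11, r12, r13, r14, r15] heap) =
      regMem [p, n, q + 1, lim, 1, base, r6, r7, nn, base + q, r10, r11, r12, r13, r14, q + 2]
        (Function.update heap (base + q) (heap (q + 2))) := by
  have e1 : (q + 2) % 2 ^ w = q + 2 := Nat.mod_eq_of_lt hqw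
  have e2 : (base + q) % 2 ^ w = base + q := Nat.mod_eq_of_lt hbq
  have e3 : heap (q + 2) % 2 ^ w = heap (q + 2) := Nat.mod_eq_of_lt hv
  have e4 : (q + 1) % 2 ^ w = q + 1 := Nat.mod_eq_of_lt (by omega)
  have l1 : 16 ≤ q + 2 := by omega
  have l2 : 16 ≤ base + q := by omega
  simp [forStep, copyUpBody, execOps_cons, execOps_nil, execOp, Operand.read, Operand.write,
    BinOp.eval,
    regMem_apply_lt, regMem_apply_of_le, update_regMem_lt, update_regMem_of_le,
    e1, e2, e3, e4, l1, l2]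

/-- Modular subtraction without wrap-around. [folklore] -/
theorem sub_mod_eq_sub {a b : ℕ} (h : b ≤ a) (ha : a < 2 ^ w) :
    (a + 2 ^ w - b) % 2 ^ w = a - b := by
  rw [show a + 2 ^ w - b = (a - b) + 2 ^ w by omega, Nat.add_mod_right, Nat.mod_eq_of_lt (by omega)]

/-- `a + (z - a) = z` in arithmetic modulo `2 ^ w`. [folklore] -/
theorem mod_add_sub_cancel {z : ℕ} (hz : z < 2 ^ w) (a : ℕ) :
    (a % 2 ^ w + (z + 2 ^ w - a % 2 ^ w) % 2 ^ w) % 2 ^ w = z := by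
  have ha : a % 2 ^ w < 2 ^ w := Nat.mod_lt _ (Nat.two_pow_pos w)
  rcases Nat.lt_or_ge z (a % 2 ^ w) with h | h
  · rw [Nat.mod_eq_of_lt (a := z + 2 ^ w - a % 2 ^ w) (by omega),
      show a % 2 ^ w + (z + 2 ^ w - a % 2 ^ w) = z + 2 ^ w by omega, Nat.add_mod_right,
      Nat.mod_eq_of_lt hz]
  · rw [show z + 2 ^ w - a % 2 ^ w = (z - a % 2 ^ w) + 2 ^ w by omega, Nat.add_mod_right,
      Nat.mod_eq_of_lt (a := z - a % 2 ^ w) (by omega),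
      show a % 2 ^ w + (z - a % 2 ^ w) = z by omega,
      Nat.mod_eq_of_lt hz]

/-- The value written by the relaxation body. [cite: FloydCACM1962, Algorithm 97] -/
def relaxOut (B inf x y z : ℕ) : ℕ :=
  if x = inf ∨ y = inf then z else min (x + y - B) z

/-- `u + (z - u) = z` in arithmetic modulo `2 ^ w`, unreduced first summand. [folklore] -/
theorem mod_add_sub_cancel' {z : ℕ} (hz : z < 2 ^ w) (u : ℕ) :
    (u + (z + 2 ^ w - u % 2 ^ w)) % 2 ^ w = z := by
  rw [Nat.add_mod]
  exact mod_add_sub_cancel hz u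

/-- One iteration of the relaxation loop: from a register file with counter `q`, pivot data
`k = q / n²`, `p = q % n²`, `i = p / n`, `j = p % n` and matrix cells `x = m[i,k]`, `y = m[k,j]`,
`z = m[i,j]` (biased values in `[B/2, 3B]`), the body writes `relaxOut B INF x y z` to cell
`(i, j)` and increments the counter. [cite: FloydCACM1962, Algorithm 97] -/
theorem relax_iter {p0 n q lim tt base B inf nn r9 r10 r11 r12 r13 r14 r15 : ℕ}
    {heap : ℕ → ℕ} {k p i j x y z : ℕ}
    (hk : q / nn = k) (hp : q % nn = p) (hi : p / n = i) (hj : p % n = j)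
    (hkn : k < n) (hin : i < n) (hjn : j < n) (hpn : p < n * n)
    (hb : 16 ≤ base) (haddr : base + n * n < 2 ^ w) (hq3 : q < n * n * n) (hn3 : n * n * n < 2 ^ w)
    (hB : 8 * B = 2 ^ w) (hinf : inf = 3 * B)
    (hxB : x ≤ 3 * B) (hyB : y ≤ 3 * B) (hzB : z ≤ 3 * B) (hxl : B ≤ 2 * x) (hyl : B ≤ 2 * y)
    (hx : heap (i * n + k + base) = x) (hy : heap (k * n + j + base) = y)
    (hz : heap (p + base) = z) :
    ∃ r9' r10' r11' r12' r13' r14' r15',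
    forStep w rT rQ relaxBody
        (regMem [p0, n, q, lim, tt, base, B, inf, nn, r9, r10, r11, r12, r13, r14, r15] heap) =
      regMem [p0, n, q + 1, lim, 1, base, B, inf, nn, r9', r10', r11', r12', r13', r14', r15']
        (Function.update heap (p + base) (relaxOut B inf x y z)) := by
  have hik : i * n + k < n * n := by nlinarith
  have hkj : k * n + j < n * n := by nlinarith
  have e1 : (i * n) % 2 ^ w = i * n := Nat.mod_eq_of_lt (by omega)
  have e2 : (i * n + k) % 2 ^ w = i * n + k := Nat.mod_eq_of_lt (by omega)
  have e3 : (i * n + k + base) % 2 ^ w = i * n + k + base := Nat.mod_eq_of_lt (by omega)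
  have e4 : (k * n) % 2 ^ w = k * n := Nat.mod_eq_of_lt (by omega)
  have e5 : (k * n + j) % 2 ^ w = k * n + j := Nat.mod_eq_of_lt (by omega)
  have e6 : (k * n + j + base) % 2 ^ w = k * n + j + base := Nat.mod_eq_of_lt (by omega)
  have e7 : (p + base) % 2 ^ w = p + base := Nat.mod_eq_of_lt (by omega)
  have ex : x % 2 ^ w = x := Nat.mod_eq_of_lt (by omega)
  have ey : y % 2 ^ w = y := Nat.mod_eq_of_lt (by omega)
  have ez : z % 2 ^ w = z := Nat.mod_eq_of_lt (by omega)
  have exy : (x + y) % 2 ^ w = x + y := Nat.mod_eq_of_lt (by omega)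
  have eB : B % 2 ^ w = B := Nat.mod_eq_of_lt (by omega)
  have einf : inf % 2 ^ w = inf := Nat.mod_eq_of_lt (by omega)
  have ecand : (x + y + 2 ^ w - B) % 2 ^ w = x + y - B := sub_mod_eq_sub (by omega) (by omega)
  have ecand' : (x + y - B) % 2 ^ w = x + y - B := Nat.mod_eq_of_lt (by omega)
  have e1w : 1 % 2 ^ w = 1 := Nat.mod_eq_of_lt (by omega)
  have eq1 : (q + 1) % 2 ^ w = q + 1 := Nat.mod_eq_of_lt (by omega)
  have l1 : 16 ≤ i * n + k + base := by omega
  have l2 : 16 ≤ k * n + j + base := by omega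
  have l3 : 16 ≤ p + base := by omega
  have key1 := mod_add_sub_cancel (w := w) (z := z) (by omega)
  have key2 := mod_add_sub_cancel' (w := w) (z := z) (by omega)
  have es : (x + y - B + (z + 2 ^ w - (x + y - B))) % 2 ^ w = z := by
    rw [show x + y - B + (z + 2 ^ w - (x + y - B)) = z + 2 ^ w by omega, Nat.add_mod_right, ez]
  by_cases hG : x = inf ∨ y = inf
  · have hout : relaxOut B inf x y z = z := by simp [relaxOut, hG]
    rw [hout]
    by_cases hxi : x = inf
    · by_cases hyi : y = inf
      · subst hxi; subst hyi
        refine ⟨?_, ?_, ?_, ?_, ?_, ?_, ?_, ?main⟩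
        case main =>
          simp [forStep, relaxBody, execOps_cons, execOps_nil, execOp, Operand.read, Operand.write,
            BinOp.eval,
            regMem_apply_lt, regMem_apply_of_le, update_regMem_lt, update_regMem_of_le,
            hk, hp, hi, hj, e1, e2, e3, e4, e5, e6, e7, ez, exy, eB, ecand, ecand', e1w,
            eq1, l1, l2, l3, hx, hy, hz, key1, ex]
          rfl
      · subst hxi
        refine ⟨?_, ?_, ?_, ?_, ?_, ?_, ?_, ?main⟩
        case main =>
          simp [forStep, relaxBody, execOps_cons, execOps_nil, execOp, Operand.read, Operand.write,
            BinOp.eval,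
            regMem_apply_lt, regMem_apply_of_le, update_regMem_lt, update_regMem_of_le,
            hk, hp, hi, hj, e1, e2, e3, e4, e5, e6, e7, ez, ey, exy, eB, ecand, ecand', e1w,
            eq1, l1, l2, l3, hx, hy, hz, key1, ex, hyi]
          rfl
    · have hyi : y = inf := hG.resolve_left hxi
      subst hyi
      refine ⟨?_, ?_, ?_, ?_, ?_, ?_, ?_, ?main⟩
      case main =>
        simp [forStep, relaxBody, execOps_cons, execOps_nil, execOp, Operand.read, Operand.write,
          BinOp.eval,
          regMem_apply_lt, regMem_apply_of_le, update_regMem_lt, update_regMem_of_le,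
          hk, hp, hi, hj, e1, e2, e3, e4, e5, e6, e7, ez, ex, exy, eB, ecand, ecand', e1w,
          eq1, l1, l2, l3, hx, hy, hz, key1, ey, hxi]
        rfl
  · have hxinf : x ≠ inf := fun h => hG (Or.inl h)
    have hyinf : y ≠ inf := fun h => hG (Or.inr h)
    by_cases hlt : x + y - B < z
    · have hout : relaxOut B inf x y z = x + y - B := by simp [relaxOut, hG, min_eq_left hlt.le]
      rw [hout]
      refine ⟨?_, ?_, ?_, ?_, ?_, ?_, ?_, ?main⟩
      case main =>
        simp [forStep, relaxBody, execOps_cons, execOps_nil, execOp, Operand.read, Operand.write,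
          BinOp.eval,
          regMem_apply_lt, regMem_apply_of_le, update_regMem_lt, update_regMem_of_le,
          hk, hp, hi, hj, e1, e2, e3, e4, e5, e6, e7, ex, ey, ez, exy, eB, ecand, ecand', e1w, eq1,
          l1, l2, l3, hx, hy, hz, hxinf, hyinf, hlt]
        rfl
    · have hout : relaxOut B inf x y z = z := by
        simp [relaxOut, hG, min_eq_right (Nat.not_lt.1 hlt)]
      rw [hout]
      refine ⟨?_, ?_, ?_, ?_, ?_, ?_, ?_, ?main⟩
      case main =>
        simp [forStep, relaxBody, execOps_cons, execOps_nil, execOp, Operand.read, Operand.write,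
          BinOp.eval,
          regMem_apply_lt, regMem_apply_of_le, update_regMem_lt, update_regMem_of_le,
          hk, hp, hi, hj, e1, e2, e3, e4, e5, e6, e7, ex, ey, ez, exy, eB, ecand, ecand', e1w, eq1,
          l1, l2, l3, hx, hy, hz, hxinf, hyinf, hlt, es]
        rfl

/-- The biased value computed by the decode body from an input code `e`. [folklore] -/
def decodeVal (B e : ℕ) : ℕ :=
  if e = 0 then B + (B + B) else B - e / 2 + (e / 2 * (e % 2) + e / 2 * (e % 2))

/-- The value written by the decode body (diagonal entries are capped at the code of `0`).
[folklore] -/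
def decodeOut (B e i j : ℕ) : ℕ :=
  if i = j ∧ B < decodeVal B e then B else decodeVal B e

/-- One iteration of the decode loop. [folklore] -/
theorem decode_iter {p0 n q lim tt base B inf nn r9 r10 r11 r12 r13 r14 r15 : ℕ}
    {heap : ℕ → ℕ} {i j e : ℕ} (hi : q / n = i) (hj : q % n = j) (hqn : q < n * n)
    (hb : 16 ≤ base) (haddr : base + n * n < 2 ^ w) (hB : 8 * B = 2 ^ w) (heB : e ≤ B)
    (he : heap (base + q) = e) :
    ∃ r9' r10' r11' r12' r13' r14' r15',
    forStep w rT rQ decodeBody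
        (regMem [p0, n, q, lim, tt, base, B, inf, nn, r9, r10, r11, r12, r13, r14, r15] heap) =
      regMem [p0, n, q + 1, lim, 1, base, B, inf, nn, r9', r10', r11', r12', r13', r14', r15']
        (Function.update heap (base + q) (decodeOut B e i j)) := by
  have ea : (base + q) % 2 ^ w = base + q := Nat.mod_eq_of_lt (by omega)
  have la : 16 ≤ base + q := by omega
  have ee : e % 2 ^ w = e := Nat.mod_eq_of_lt (by omega)
  have eB : B % 2 ^ w = B := Nat.mod_eq_of_lt (by omega)
  have e1w : 1 % 2 ^ w = 1 := Nat.mod_eq_of_lt (by omega)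
  have eq1 : (q + 1) % 2 ^ w = q + 1 := Nat.mod_eq_of_lt (by omega)
  have eBB : (B + B) % 2 ^ w = B + B := Nat.mod_eq_of_lt (by omega)
  have eBBB : (B + (B + B)) % 2 ^ w = B + (B + B) := Nat.mod_eq_of_lt (by omega)
  have hlt3 : B < B + (B + B) := by omega
  have e3B : (B + (B + B) + 2 ^ w - B) % 2 ^ w = B + B := by
    rw [sub_mod_eq_sub (by omega) (by omega)]; omega
  have e3B' : (B + B) % 2 ^ w = B + B := eBB
  have efin : (B + (B + B) + 2 ^ w - (B + B)) % 2 ^ w = B := by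
    rw [sub_mod_eq_sub (by omega) (by omega)]; omega
  by_cases he0 : e = 0
  · subst he0
    by_cases hij : i = j
    · subst hij
      have hout : decodeOut B 0 i i = B := by simp [decodeOut, decodeVal, hlt3]
      rw [hout]
      refine ⟨?_, ?_, ?_, ?_, ?_, ?_, ?_, ?main⟩
      case main =>
        simp [forStep, decodeBody, execOps_cons, execOps_nil, execOp, Operand.read, Operand.write,
          BinOp.eval,
          regMem_apply_lt, regMem_apply_of_le, update_regMem_lt, update_regMem_of_le,
          hi, hj, ea, la, eB, e1w, eq1, eBB, eBBB, hlt3, e3B, efin, he]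
        rfl
    · have hout : decodeOut B 0 i j = B + (B + B) := by simp [decodeOut, decodeVal, hij]
      rw [hout]
      refine ⟨?_, ?_, ?_, ?_, ?_, ?_, ?_, ?main⟩
      case main =>
        simp [forStep, decodeBody, execOps_cons, execOps_nil, execOp, Operand.read, Operand.write,
          BinOp.eval,
          regMem_apply_lt, regMem_apply_of_le, update_regMem_lt, update_regMem_of_le,
          hi, hj, ea, la, eB, eq1, eBB, eBBB, hij, he]
        rfl
  · -- a finite entry: `s = B - h + 2 h par`
    set h := e / 2 with hh
    set par := e % 2 with hpar
    have hhB : h ≤ B := by omega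
    have hpar1 : par ≤ 1 := by omega
    have hhp : h * par ≤ h := by nlinarith
    have es1 : (B + 2 ^ w - h) % 2 ^ w = B - h := sub_mod_eq_sub hhB (by omega)
    have ehm : h % 2 ^ w = h := Nat.mod_eq_of_lt (by omega)
    have eu : (h * par) % 2 ^ w = h * par := Nat.mod_eq_of_lt (by omega)
    have eu2 : (h * par + h * par) % 2 ^ w = h * par + h * par := Nat.mod_eq_of_lt (by omega)
    have es2 : (B - h + (h * par + h * par)) % 2 ^ w = B - h + (h * par + h * par) :=
      Nat.mod_eq_of_lt (by omega)
    have hval : decodeVal B e = B - h + (h * par + h * par) := by simp [decodeVal, he0, hh, hpar]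
    by_cases hij : i = j
    · subst hij
      by_cases hlt : B < B - h + (h * par + h * par)
      · have hout : decodeOut B e i i = B := by simp [decodeOut, hval, hlt]
        rw [hout]
        have ey : (B - h + (h * par + h * par) + 2 ^ w - B) % 2 ^ w =
            B - h + (h * par + h * par) - B := sub_mod_eq_sub hlt.le (by omega)
        have efin' : (B - h + (h * par + h * par) + 2 ^ w - (B - h + (h * par + h * par) - B)) %
            2 ^ w = B := by
          rw [sub_mod_eq_sub (by omega) (by omega)]; omega
        have ey2 : (B - h + (h * par + h * par) - B) % 2 ^ w = B - h + (h * par + h * par) - B :=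
          Nat.mod_eq_of_lt (by omega)
        refine ⟨?_, ?_, ?_, ?_, ?_, ?_, ?_, ?main⟩
        case main =>
          simp [forStep, decodeBody, execOps_cons, execOps_nil, execOp, Operand.read, Operand.write,
            BinOp.eval, regMem_apply_lt, regMem_apply_of_le, update_regMem_lt,
            update_regMem_of_le, hi, hj, ea, la, eB, e1w, eq1, he, ee, he0, ← hh, ← hpar, es1,
            ehm, eu, eu2, es2, hlt, ey, efin', ey2]
          rfl
      · have hout : decodeOut B e i i = B - h + (h * par + h * par) := by
          simp [decodeOut, hval, hlt]
        rw [hout]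
        have efin' : (B - h + (h * par + h * par) + 2 ^ w - 0) % 2 ^ w =
            B - h + (h * par + h * par) := by
          rw [Nat.sub_zero, Nat.add_mod_right, es2]
        refine ⟨?_, ?_, ?_, ?_, ?_, ?_, ?_, ?main⟩
        case main =>
          simp [forStep, decodeBody, execOps_cons, execOps_nil, execOp, Operand.read, Operand.write,
            BinOp.eval, regMem_apply_lt, regMem_apply_of_le, update_regMem_lt,
            update_regMem_of_le, hi, hj, ea, la, eB, eq1, he, ee, he0, ← hh, ← hpar, es1,
            ehm, eu, eu2, es2, hlt]
          rfl
    · have hout : decodeOut B e i j = B - h + (h * par + h * par) := by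
        simp [decodeOut, hval, hij]
      rw [hout]
      have efin' : (B - h + (h * par + h * par) + 2 ^ w - 0) % 2 ^ w =
          B - h + (h * par + h * par) := by
        rw [Nat.sub_zero, Nat.add_mod_right, es2]
      refine ⟨?_, ?_, ?_, ?_, ?_, ?_, ?_, ?main⟩
      case main =>
        simp [forStep, decodeBody, execOps_cons, execOps_nil, execOp, Operand.read, Operand.write,
          BinOp.eval, regMem_apply_lt, regMem_apply_of_le, update_regMem_lt,
          update_regMem_of_le, hi, hj, ea, la, eB, eq1, he, ee, he0, ← hh, ← hpar, es1,
          ehm, eu, eu2, es2, hij]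
        rfl

/-- The output code computed by the encode body from a biased value `b`. [folklore] -/
def encodeOut (B inf b : ℕ) : ℕ :=
  if b = inf then 0 else if b < B then B - b + (B - b) else b - B + (b - B) + 1

/-- One iteration of the encode loop. [folklore] -/
theorem encode_iter {p0 n q lim tt base B inf nn r9 r10 r11 r12 r13 r14 r15 : ℕ}
    {heap : ℕ → ℕ} {b : ℕ} (hqn : q < n * n)
    (hb : 16 ≤ base) (haddr : base + n * n < 2 ^ w) (hB : 8 * B = 2 ^ w) (hinf : inf = 3 * B)
    (hbB : b ≤ 3 * B) (hbv : heap (base + q) = b) :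
    ∃ r9' r10' r11' r12' r13' r14' r15',
    forStep w rT rQ encodeBody
        (regMem [p0, n, q, lim, tt, base, B, inf, nn, r9, r10, r11, r12, r13, r14, r15] heap) =
      regMem [p0, n, q + 1, lim, 1, base, B, inf, nn, r9', r10', r11', r12', r13', r14', r15']
        (Function.update heap (base + q) (encodeOut B inf b)) := by
  have ea : (base + q) % 2 ^ w = base + q := Nat.mod_eq_of_lt (by omega)
  have la : 16 ≤ base + q := by omega
  have eb : b % 2 ^ w = b := Nat.mod_eq_of_lt (by omega)
  have eB : B % 2 ^ w = B := Nat.mod_eq_of_lt (by omega)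
  have einf : inf % 2 ^ w = inf := Nat.mod_eq_of_lt (by omega)
  have e1w : 1 % 2 ^ w = 1 := Nat.mod_eq_of_lt (by omega)
  have eq1 : (q + 1) % 2 ^ w = q + 1 := Nat.mod_eq_of_lt (by omega)
  by_cases hbi : b = inf
  · subst hbi
    have hout : encodeOut B (3 * B) (3 * B) = 0 := by simp [encodeOut]
    subst hinf
    rw [hout]
    refine ⟨?_, ?_, ?_, ?_, ?_, ?_, ?_, ?main⟩
    case main =>
      simp [forStep, encodeBody, execOps_cons, execOps_nil, execOp, Operand.read, Operand.write,
        BinOp.eval, regMem_apply_lt, regMem_apply_of_le, update_regMem_lt,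
        update_regMem_of_le, ea, la, eB, e1w, eq1, hbv, eb]
      rfl
  · by_cases hlt : b < B
    · have hout : encodeOut B inf b = B - b + (B - b) := by simp [encodeOut, hbi, hlt]
      rw [hout]
      have eu : (B + 2 ^ w - b) % 2 ^ w = B - b := sub_mod_eq_sub hlt.le (by omega)
      have eu2 : (B - b + (B - b)) % 2 ^ w = B - b + (B - b) := Nat.mod_eq_of_lt (by omega)
      refine ⟨?_, ?_, ?_, ?_, ?_, ?_, ?_, ?main⟩
      case main =>
        simp [forStep, encodeBody, execOps_cons, execOps_nil, execOp, Operand.read, Operand.write,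
          BinOp.eval, regMem_apply_lt, regMem_apply_of_le, update_regMem_lt,
          update_regMem_of_le, ea, la, eB, e1w, eq1, hbv, eb, hbi, hlt, eu, eu2]
        rfl
    · have hout : encodeOut B inf b = b - B + (b - B) + 1 := by simp [encodeOut, hbi, hlt]
      rw [hout]
      have es : (b + 2 ^ w - B) % 2 ^ w = b - B := sub_mod_eq_sub (Nat.not_lt.1 hlt) (by omega)
      have es2 : (b - B + (b - B)) % 2 ^ w = b - B + (b - B) := Nat.mod_eq_of_lt (by omega)
      have es3 : (b - B + (b - B) + 1) % 2 ^ w = b - B + (b - B) + 1 := Nat.mod_eq_of_lt (by omega)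
      refine ⟨?_, ?_, ?_, ?_, ?_, ?_, ?_, ?main⟩
      case main =>
        simp [forStep, encodeBody, execOps_cons, execOps_nil, execOp, Operand.read, Operand.write,
          BinOp.eval, regMem_apply_lt, regMem_apply_of_le, update_regMem_lt,
          update_regMem_of_le, ea, la, eB, e1w, eq1, hbv, eb, hbi, hlt, es, es2, es3]
        rfl

/-- One iteration of the copy-down loop. [folklore] -/
theorem copyDown_iter {p n q lim tt base r6 r7 nn r9 r10 r11 r12 r13 r14 r15 : ℕ}
    {heap : ℕ → ℕ} (hq : 14 ≤ q) (hqw : q + 2 < 2 ^ w) (hbq : base + q < 2 ^ w) (hb : 16 ≤ base)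
    (hv : heap (base + q) < 2 ^ w) :
    forStep w rT rQ copyDownBody
        (regMem [p, n, q, lim, tt, base, r6, r7, nn, r9, r10, r11, r12, r13, r14, r15] heap) =
      regMem [p, n, q + 1, lim, 1, base, r6, r7, nn, q + 2, r10, r11, r12, r13, r14, base + q]
        (Function.update heap (q + 2) (heap (base + q))) := by
  have e1 : (q + 2) % 2 ^ w = q + 2 := Nat.mod_eq_of_lt hqw
  have e2 : (base + q) % 2 ^ w = base + q := Nat.mod_eq_of_lt hbq
  have e3 : heap (base + q) % 2 ^ w = heap (base + q) := Nat.mod_eq_of_lt hv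
  have e4 : (q + 1) % 2 ^ w = q + 1 := Nat.mod_eq_of_lt (by omega)
  have l1 : 16 ≤ q + 2 := by omega
  have l2 : 16 ≤ base + q := by omega
  simp [forStep, copyDownBody, execOps_cons, execOps_nil, execOp, Operand.read, Operand.write,
    BinOp.eval,
    regMem_apply_lt, regMem_apply_of_le, update_regMem_lt, update_regMem_of_le,
    e1, e2, e3, e4, l1, l2]

end bodies

/-! ## The loop phases -/

section phases

variable {w : ℕ}

attribute [local simp] rP rN rQ rLIM rT rBASE rB rINF rNN rX rY rZ rS rU rV rA

/-- Induction along the iterates of a function, up to a horizon `K`. [folklore] -/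
theorem iterate_ind {α : Type*} {F : α → α} {K : ℕ} (P : ℕ → α → Prop) (a : α) (h0 : P 0 a)
    (hs : ∀ t < K, ∀ b, P t b → P (t + 1) (F b)) : ∀ t ≤ K, P t (F^[t] a) := by
  intro t
  induction t with
  | zero => intro _; simpa using h0
  | succ t ih =>
    intro ht
    rw [Function.iterate_succ_apply']
    exact hs t (by omega) _ (ih (by omega))

/-- The heap during the decode phase: the first `t` matrix cells are decoded. [folklore] -/
def heapDec (n base B : ℕ) (E : ℕ → ℕ) (heap : ℕ → ℕ) (t : ℕ) : ℕ → ℕ := fun a =>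
  if base ≤ a ∧ a < base + t then decodeOut B (E (a - base)) ((a - base) / n) ((a - base) % n)
  else heap a

/-- **The decode phase.** [folklore] -/
theorem decode_phase {p0 n base B inf r4 r9 r10 r11 r12 r13 r14 r15 : ℕ} {E heap : ℕ → ℕ}
    (hb : 16 ≤ base) (haddr : base + n * n < 2 ^ w) (hB : 8 * B = 2 ^ w)
    (hE : ∀ q < n * n, E q ≤ B) (hheap : ∀ q < n * n, heap (base + q) = E q) :
    ∀ t ≤ n * n, ∃ r4' r9' r10' r11' r12' r13' r14' r15',
      (forStep w rT rQ decodeBody)^[t]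
          (regMem [p0, n, 0, n * n, r4, base, B, inf, n * n, r9, r10, r11, r12, r13, r14, r15]
            heap) =
        regMem [p0, n, t, n * n, r4', base, B, inf, n * n, r9', r10', r11', r12', r13', r14', r15']
          (heapDec n base B E heap t) := by
  refine iterate_ind (K := n * n)
    (fun t m => ∃ r4' r9' r10' r11' r12' r13' r14' r15',
      m = regMem [p0, n, t, n * n, r4', base, B, inf, n * n, r9', r10', r11', r12', r13', r14',
        r15']
        (heapDec n base B E heap t)) _ ⟨r4, r9, r10, r11, r12, r13, r14, r15, ?_⟩ ?_
  · congr 1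
    funext a
    simp [heapDec]
  · rintro t ht m ⟨r4', r9', r10', r11', r12', r13', r14', r15', rfl⟩
    have hEt : heapDec n base B E heap t (base + t) = E t := by
      simp only [heapDec, Nat.add_sub_cancel_left]
      rw [if_neg (by omega)]
      exact hheap t ht
    obtain ⟨s9, s10, s11, s12, s13, s14, s15, hF⟩ :=
      decode_iter (w := w) (p0 := p0) (lim := n * n) (tt := r4') (inf := inf) (nn := n * n)
        (r9 := r9') (r10 := r10') (r11 := r11') (r12 := r12') (r13 := r13') (r14 := r14')
        (r15 := r15') (i := t / n) (j := t % n) rfl rfl ht hb haddr hB (hE t ht) hEt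
    refine ⟨1, s9, s10, s11, s12, s13, s14, s15, ?_⟩
    rw [hF]
    congr 1
    funext a
    by_cases ha : a = base + t
    · subst ha
      rw [Function.update_self]
      simp [heapDec]
    · rw [Function.update_of_ne ha]
      simp only [heapDec]
      split_ifs <;> first | rfl | omega

/-- The heap during the encode phase: the first `t` matrix cells are encoded. [folklore] -/
def heapEnc (base B inf : ℕ) (heap : ℕ → ℕ) (t : ℕ) : ℕ → ℕ := fun a =>
  if base ≤ a ∧ a < base + t then encodeOut B inf (heap a) else heap a

/-- **The encode phase.** [folklore] -/
theorem encode_phase {p0 n base B inf r4 r9 r10 r11 r12 r13 r14 r15 : ℕ} {heap : ℕ → ℕ}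
    (hb : 16 ≤ base) (haddr : base + n * n < 2 ^ w) (hB : 8 * B = 2 ^ w) (hinf : inf = 3 * B)
    (hheap : ∀ q < n * n, heap (base + q) ≤ 3 * B) :
    ∀ t ≤ n * n, ∃ r4' r9' r10' r11' r12' r13' r14' r15',
      (forStep w rT rQ encodeBody)^[t]
          (regMem [p0, n, 0, n * n, r4, base, B, inf, n * n, r9, r10, r11, r12, r13, r14, r15]
            heap) =
        regMem [p0, n, t, n * n, r4', base, B, inf, n * n, r9', r10', r11', r12', r13', r14', r15']
          (heapEnc base B inf heap t) := by
  refine iterate_ind (K := n * n)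
    (fun t m => ∃ r4' r9' r10' r11' r12' r13' r14' r15',
      m = regMem [p0, n, t, n * n, r4', base, B, inf, n * n, r9', r10', r11', r12', r13', r14',
        r15']
        (heapEnc base B inf heap t)) _ ⟨r4, r9, r10, r11, r12, r13, r14, r15, ?_⟩ ?_
  · congr 1
    funext a
    simp [heapEnc]
  · rintro t ht m ⟨r4', r9', r10', r11', r12', r13', r14', r15', rfl⟩
    have hbt : heapEnc base B inf heap t (base + t) = heap (base + t) := by
      simp only [heapEnc]
      rw [if_neg (by omega)]
    obtain ⟨s9, s10, s11, s12, s13, s14, s15, hF⟩ :=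
      encode_iter (w := w) (p0 := p0) (lim := n * n) (tt := r4') (nn := n * n)
        (r9 := r9') (r10 := r10') (r11 := r11') (r12 := r12') (r13 := r13') (r14 := r14')
        (r15 := r15') ht hb haddr hB hinf (hheap t ht) hbt
    refine ⟨1, s9, s10, s11, s12, s13, s14, s15, ?_⟩
    rw [hF]
    congr 1
    funext a
    by_cases ha : a = base + t
    · subst ha
      rw [Function.update_self]
      simp [heapEnc]
    · rw [Function.update_of_ne ha]
      simp only [heapEnc]
      split_ifs <;> first | rfl | omega

/-- The matrix cells during the relaxation phase (flat index ↦ biased value), iteration by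
iteration: Floyd's in-place update in the order pivot, row, column.
[cite: FloydCACM1962, Algorithm 97] -/
def relaxSeq (n B inf : ℕ) (V : ℕ → ℕ) : ℕ → ℕ → ℕ
  | 0 => V
  | t + 1 =>
    Function.update (relaxSeq n B inf V t) (t % (n * n))
      (relaxOut B inf (relaxSeq n B inf V t (t % (n * n) / n * n + t / (n * n)))
        (relaxSeq n B inf V t (t / (n * n) * n + t % (n * n) % n))
        (relaxSeq n B inf V t (t % (n * n))))

/-- The heap during the relaxation phase. [folklore] -/
def heapRel (n base : ℕ) (heap : ℕ → ℕ) (R : ℕ → ℕ → ℕ) (t : ℕ) : ℕ → ℕ := fun a =>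
  if base ≤ a ∧ a < base + n * n then R t (a - base) else heap a

/-- **The relaxation phase** (`n³` iterations), for cell values that stay in `[B/2, 3B]`.
[cite: FloydCACM1962, Algorithm 97] -/
theorem relax_phase {p0 n base B inf r4 r9 r10 r11 r12 r13 r14 r15 : ℕ} {V heap : ℕ → ℕ}
    (hb : 16 ≤ base) (haddr : base + n * n < 2 ^ w) (hn3 : n * n * n < 2 ^ w)
    (hB : 8 * B = 2 ^ w) (hinf : inf = 3 * B)
    (hV : ∀ t ≤ n * n * n, ∀ q < n * n,
      relaxSeq n B inf V t q ≤ 3 * B ∧ B ≤ 2 * relaxSeq n B inf V t q)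
    (hheap : ∀ q < n * n, heap (base + q) = V q) :
    ∀ t ≤ n * n * n, ∃ r4' r9' r10' r11' r12' r13' r14' r15',
      (forStep w rT rQ relaxBody)^[t]
          (regMem [p0, n, 0, n * n * n, r4, base, B, inf, n * n, r9, r10, r11, r12, r13, r14, r15]
            heap) =
        regMem [p0, n, t, n * n * n, r4', base, B, inf, n * n, r9', r10', r11', r12', r13', r14',
            r15'] (heapRel n base heap (relaxSeq n B inf V) t) := by
  refine iterate_ind (K := n * n * n)
    (fun t m => ∃ r4' r9' r10' r11' r12' r13' r14' r15',
      m = regMem [p0, n, t, n * n * n, r4', base, B, inf, n * n, r9', r10', r11', r12', r13', r14',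
        r15'] (heapRel n base heap (relaxSeq n B inf V) t)) _
    ⟨r4, r9, r10, r11, r12, r13, r14, r15, ?_⟩ ?_
  · congr 1
    funext a
    simp only [heapRel, relaxSeq]
    split_ifs with h
    · obtain ⟨q, rfl⟩ : ∃ q, a = base + q := ⟨a - base, by omega⟩
      rw [hheap q (by omega), Nat.add_sub_cancel_left]
    · rfl
  · rintro t ht m ⟨r4', r9', r10', r11', r12', r13', r14', r15', rfl⟩
    have hn : 0 < n := Nat.pos_of_ne_zero (by rintro rfl; simp at ht)
    have hN : 0 < n * n := Nat.mul_pos hn hn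
    have hkn : t / (n * n) < n := FloydWarshall.div_sq_lt_of_lt_cube ht
    have hpn : t % (n * n) < n * n := Nat.mod_lt _ hN
    have hin : t % (n * n) / n < n := (Nat.div_lt_iff_lt_mul hn).2 hpn
    have hjn : t % (n * n) % n < n := Nat.mod_lt _ hn
    obtain ⟨k, hk⟩ : ∃ k, t / (n * n) = k := ⟨_, rfl⟩
    obtain ⟨p, hp⟩ : ∃ p, t % (n * n) = p := ⟨_, rfl⟩
    obtain ⟨i, hi⟩ : ∃ i, p / n = i := ⟨_, rfl⟩
    obtain ⟨j, hj⟩ : ∃ j, p % n = j := ⟨_, rfl⟩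
    rw [hk] at hkn
    rw [hp] at hpn hin hjn
    rw [hi] at hin
    rw [hj] at hjn
    have hik : i * n + k < n * n := by nlinarith
    have hkj : k * n + j < n * n := by nlinarith
    set R := relaxSeq n B inf V with hR
    have hx : heapRel n base heap R t (i * n + k + base) = R t (i * n + k) := by
      simp only [heapRel]; rw [if_pos (by omega)]; congr 1; omega
    have hy : heapRel n base heap R t (k * n + j + base) = R t (k * n + j) := by
      simp only [heapRel]; rw [if_pos (by omega)]; congr 1; omega
    have hz : heapRel n base heap R t (p + base) = R t p := by
      simp only [heapRel]; rw [if_pos (by omega)]; congr 1; omega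
    obtain ⟨s9, s10, s11, s12, s13, s14, s15, hF⟩ :=
      relax_iter (w := w) (p0 := p0) (lim := n * n * n) (tt := r4') (nn := n * n)
        (r9 := r9') (r10 := r10') (r11 := r11') (r12 := r12') (r13 := r13') (r14 := r14')
        (r15 := r15') hk hp hi hj hkn hin hjn hpn hb haddr ht hn3 hB hinf
        (hV t ht.le _ hik).1 (hV t ht.le _ hkj).1 (hV t ht.le _ hpn).1
        (hV t ht.le _ hik).2 (hV t ht.le _ hkj).2 hx hy hz
    refine ⟨1, s9, s10, s11, s12, s13, s14, s15, ?_⟩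
    rw [hF]
    congr 1
    funext a
    have hstep : R (t + 1) = Function.update (R t) p
        (relaxOut B inf (R t (i * n + k)) (R t (k * n + j)) (R t p)) := by
      simp only [hR, relaxSeq, hp, hk, hi, hj]
    by_cases ha : a = p + base
    · subst ha
      rw [Function.update_self]
      simp only [heapRel]
      rw [if_pos (by omega), hstep, show p + base - base = p by omega, Function.update_self]
    · rw [Function.update_of_ne ha]
      simp only [heapRel]
      split_ifs with h1
      · rw [hstep, Function.update_of_ne (by omega)]
      · rfl

/-- The heap during the copy-up phase. [folklore] -/
def heapCU (base : ℕ) (heap : ℕ → ℕ) (t : ℕ) : ℕ → ℕ := fun a =>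
  if base + 14 ≤ a ∧ a < base + 14 + t then heap (a - base + 2) else heap a

/-- **The copy-up phase** (`n² - 14` iterations, counter from `14`). [folklore] -/
theorem copyUp_phase {p0 n base r4 r6 r7 r9 r10 r11 r12 r13 r14 r15 : ℕ} {heap : ℕ → ℕ}
    (hbase : base = n * n + 16) (haddr : base + n * n < 2 ^ w) (hheap : ∀ a, heap a < 2 ^ w) :
    ∀ t ≤ n * n - 14, ∃ r4' r9' r10' r11' r12' r13' r14' r15',
      (forStep w rT rQ copyUpBody)^[t]
          (regMem [p0, n, 14, n * n, r4, base, r6, r7, n * n, r9, r10, r11, r12, r13, r14, r15]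
            heap) =
        regMem [p0, n, 14 + t, n * n, r4', base, r6, r7, n * n, r9', r10', r11', r12', r13', r14',
          r15']
          (heapCU base heap t) := by
  refine iterate_ind (K := n * n - 14)
    (fun t m => ∃ r4' r9' r10' r11' r12' r13' r14' r15',
      m = regMem [p0, n, 14 + t, n * n, r4', base, r6, r7, n * n, r9', r10', r11', r12', r13', r14',
        r15'] (heapCU base heap t)) _ ⟨r4, r9, r10, r11, r12, r13, r14, r15, ?_⟩ ?_
  · congr 1
    funext a
    simp [heapCU]
  · rintro t ht m ⟨r4', r9', r10', r11', r12', r13', r14', r15', rfl⟩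
    have hsrc : heapCU base heap t (14 + t + 2) = heap (14 + t + 2) := by
      simp only [heapCU]; rw [if_neg (by omega)]
    have h1 : 14 ≤ 14 + t := by omega
    have h2 : 14 + t + 2 < 2 ^ w := by omega
    have h3 : base + (14 + t) < 2 ^ w := by omega
    have h4 : 16 ≤ base := by omega
    have h5 : heapCU base heap t (14 + t + 2) < 2 ^ w := by rw [hsrc]; exact hheap _
    have hF := copyUp_iter (w := w) (p := p0) (n := n) (lim := n * n) (tt := r4') (r6 := r6)
      (r7 := r7) (nn := n * n) (r9 := r9') (r10 := r10') (r11 := r11') (r12 := r12') (r13 := r13')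
      (r14 := r14') (r15 := r15') h1 h2 h3 h4 h5
    refine ⟨1, base + (14 + t), r10', r11', r12', r13', r14', 14 + t + 2, ?_⟩
    rw [hF, show 14 + t + 1 = 14 + (t + 1) by omega]
    congr 1
    funext a
    by_cases ha : a = base + (14 + t)
    · subst ha
      rw [Function.update_self, hsrc]
      simp only [heapCU]
      rw [if_pos (by omega)]
      congr 1; omega
    · rw [Function.update_of_ne ha]
      simp only [heapCU]
      split_ifs <;> first | rfl | omega

/-- The heap during the copy-down phase. [folklore] -/
def heapCD (base : ℕ) (heap : ℕ → ℕ) (t : ℕ) : ℕ → ℕ := fun a =>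
  if 16 ≤ a ∧ a < 16 + t then heap (a - 2 + base) else heap a

/-- **The copy-down phase** (`n² - 14` iterations, counter from `14`). [folklore] -/
theorem copyDown_phase {p0 n base r4 r6 r7 r9 r10 r11 r12 r13 r14 r15 : ℕ} {heap : ℕ → ℕ}
    (hbase : base = n * n + 16) (haddr : base + n * n < 2 ^ w)
    (hheap : ∀ q < n * n, heap (base + q) < 2 ^ w) :
    ∀ t ≤ n * n - 14, ∃ r4' r9' r10' r11' r12' r13' r14' r15',
      (forStep w rT rQ copyDownBody)^[t]
          (regMem [p0, n, 14, n * n, r4, base, r6, r7, n * n, r9, r10, r11, r12, r13, r14, r15]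
            heap) =
        regMem [p0, n, 14 + t, n * n, r4', base, r6, r7, n * n, r9', r10', r11', r12', r13', r14',
          r15']
          (heapCD base heap t) := by
  refine iterate_ind (K := n * n - 14)
    (fun t m => ∃ r4' r9' r10' r11' r12' r13' r14' r15',
      m = regMem [p0, n, 14 + t, n * n, r4', base, r6, r7, n * n, r9', r10', r11', r12', r13', r14',
        r15'] (heapCD base heap t)) _ ⟨r4, r9, r10, r11, r12, r13, r14, r15, ?_⟩ ?_
  · congr 1
    funext a
    simp [heapCD]
  · rintro t ht m ⟨r4', r9', r10', r11', r12', r13', r14', r15', rfl⟩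
    have hsrc : heapCD base heap t (base + (14 + t)) = heap (base + (14 + t)) := by
      simp only [heapCD]; rw [if_neg (by omega)]
    have h1 : 14 ≤ 14 + t := by omega
    have h2 : 14 + t + 2 < 2 ^ w := by omega
    have h3 : base + (14 + t) < 2 ^ w := by omega
    have h4 : 16 ≤ base := by omega
    have h5 : heapCD base heap t (base + (14 + t)) < 2 ^ w := by
      rw [hsrc]; exact hheap _ (by omega)
    have hF := copyDown_iter (w := w) (p := p0) (n := n) (lim := n * n) (tt := r4') (r6 := r6)
      (r7 := r7) (nn := n * n) (r9 := r9') (r10 := r10') (r11 := r11') (r12 := r12') (r13 := r13')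
      (r14 := r14') (r15 := r15') h1 h2 h3 h4 h5
    refine ⟨1, 14 + t + 2, r10', r11', r12', r13', r14', base + (14 + t), ?_⟩
    rw [hF, show 14 + t + 1 = 14 + (t + 1) by omega]
    congr 1
    funext a
    by_cases ha : a = 14 + t + 2
    · subst ha
      rw [Function.update_self, hsrc]
      simp only [heapCD]
      rw [if_pos (by omega)]
      congr 1; omega
    · rw [Function.update_of_ne ha]
      simp only [heapCD]
      split_ifs <;> first | rfl | omega

end phases

/-! ## Biased words for bounded weights -/

section glue

/-- The biased word representing a weight with respect to the bias `B`: `⊤ ↦ 3 B` (the code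
`INF`), `z ↦ B + z`. [folklore] -/
def encB (B : ℕ) : WithTop ℤ → ℕ
  | ⊤ => 3 * B
  | (z : ℤ) => ((B : ℤ) + z).toNat

/-- The biased word of `⊤` is `INF = 3 B`. [folklore] -/
@[simp] theorem encB_top (B : ℕ) : encB B ⊤ = 3 * B := rfl

/-- The biased word of a finite weight `z` is `B + z`. [folklore] -/
theorem encB_coe (B : ℕ) (z : ℤ) : encB B z = ((B : ℤ) + z).toNat := rfl

/-- Biased words of `M`-bounded weights lie in `[B / 2, 3 B]` when `2 M ≤ B`. [folklore] -/
theorem encB_bounds {B M : ℕ} (hM : 2 * M ≤ B) {d : WithTop ℤ} (hd : IsBddWeight M d) :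
    encB B d ≤ 3 * B ∧ B ≤ 2 * encB B d := by
  rcases hd with rfl | ⟨z, rfl, hz⟩
  · rw [encB_top]; omega
  · rw [encB_coe]
    obtain ⟨h1, h2⟩ := abs_le.1 hz
    omega

/-- Finite weights have biased words different from `INF = 3 B`. [folklore] -/
theorem encB_coe_ne {B M : ℕ} (hB : 0 < B) (hM : 2 * M ≤ B) {z : ℤ} (hz : |z| ≤ M) :
    encB B z ≠ 3 * B := by
  rw [encB_coe]
  obtain ⟨h1, h2⟩ := abs_le.1 hz
  omega

/-- **Relaxation on biased words is relaxation on weights.** [cite: FloydCACM1962, Algorithm 97] -/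
theorem relaxOut_encB {B M : ℕ} (hB : 0 < B) (hM : 2 * M ≤ B) {x y z : WithTop ℤ}
    (hx : IsBddWeight M x) (hy : IsBddWeight M y) (hz : IsBddWeight M z) :
    relaxOut B (3 * B) (encB B x) (encB B y) (encB B z) = encB B (min z (x + y)) := by
  rcases hx with rfl | ⟨a, rfl, ha⟩
  · simp [relaxOut]
  rcases hy with rfl | ⟨b, rfl, hb⟩
  · simp [relaxOut]
  have hxa := encB_coe_ne hB hM ha
  have hyb := encB_coe_ne hB hM hb
  rw [relaxOut, if_neg (not_or.2 ⟨hxa, hyb⟩), ← WithTop.coe_add]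
  obtain ⟨ha1, ha2⟩ := abs_le.1 ha
  obtain ⟨hb1, hb2⟩ := abs_le.1 hb
  rcases hz with rfl | ⟨c, rfl, hc⟩
  · rw [min_eq_right le_top, encB_top, encB_coe, encB_coe, encB_coe]
    omega
  · obtain ⟨hc1, hc2⟩ := abs_le.1 hc
    rw [← WithTop.coe_min, encB_coe, encB_coe, encB_coe, encB_coe]
    omega

/-- **Decoding an input code gives the biased word** of the weight. [folklore] -/
theorem decodeVal_encode {B M : ℕ} (hM : M ≤ B) {d : WithTop ℤ} (hd : IsBddWeight M d) :
    decodeVal B (encodeWithTopInt d) = encB B d := by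
  rcases hd with rfl | ⟨z, rfl, hz⟩
  · simp [decodeVal, encodeWithTopInt]; ring
  · obtain ⟨h1, h2⟩ := abs_le.1 hz
    cases z with
    | ofNat k =>
      simp only [decodeVal, encodeWithTopInt, encB_coe, Int.ofNat_eq_natCast, encodeInt_natCast]
      have e1 : (2 * k + 1) / 2 = k := by omega
      have e2 : (2 * k + 1) % 2 = 1 := by omega
      simp only [Nat.add_eq_zero_iff, one_ne_zero, and_false, if_false, e1, e2]
      simp only [Int.ofNat_eq_natCast] at h2
      omega
    | negSucc k =>
      simp only [decodeVal, encodeWithTopInt, encB_coe, encodeInt_negSucc]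
      have e1 : (2 * k + 1 + 1) / 2 = k + 1 := by omega
      have e2 : (2 * k + 1 + 1) % 2 = 0 := by omega
      simp only [Nat.add_eq_zero_iff, one_ne_zero, and_false, if_false, e1, e2]
      rw [Int.negSucc_eq] at h1 ⊢
      omega

/-- The biased word of `min d 0` is `min (encB B d) B`. [folklore] -/
theorem encB_min_zero {B M : ℕ} (hM : M ≤ B) {d : WithTop ℤ} (hd : IsBddWeight M d) :
    encB B (min d 0) = if B < encB B d then B else encB B d := by
  rcases hd with rfl | ⟨z, rfl, hz⟩
  · rw [min_eq_right le_top, encB_top, show (0 : WithTop ℤ) = ((0 : ℤ) : WithTop ℤ) from rfl,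
      encB_coe]
    split_ifs with h
    · simp
    · omega
  · obtain ⟨h1, h2⟩ := abs_le.1 hz
    rw [show (0 : WithTop ℤ) = ((0 : ℤ) : WithTop ℤ) from rfl, ← WithTop.coe_min, encB_coe,
      encB_coe]
    split_ifs with h <;> omega

/-- **Decoding the input matrix gives `D⁽⁰⁾` in biased words.** [folklore] -/
theorem decodeOut_encode {n B M : ℕ} (hM : M ≤ B) {W : Matrix (Fin n) (Fin n) (WithTop ℤ)}
    (hW : HasBoundedWeights W M) (i j : Fin n) :
    decodeOut B (encodeWithTopInt (W i j)) i j = encB B (fwInit W i j) := by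
  rw [decodeOut, decodeVal_encode hM (hW i j), fwInit_apply]
  by_cases hij : i = j
  · subst hij
    rw [if_pos rfl, encB_min_zero hM (hW i i)]
    simp
  · rw [if_neg hij, if_neg]
    exact fun h => hij (Fin.ext h.1)

/-- **Encoding a biased word gives the output code** of the weight. [folklore] -/
theorem encodeOut_encB {B M : ℕ} (hB : 0 < B) (hM : 2 * M ≤ B) {d : WithTop ℤ}
    (hd : IsBddWeight M d) : encodeOut B (3 * B) (encB B d) = encodeWithTopInt d := by
  rcases hd with rfl | ⟨z, rfl, hz⟩
  · simp [encodeOut, encodeWithTopInt]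
  · have hne := encB_coe_ne hB hM hz
    obtain ⟨h1, h2⟩ := abs_le.1 hz
    rw [encodeOut, if_neg hne]
    cases z with
    | ofNat k =>
      simp only [encodeWithTopInt, encB_coe, Int.ofNat_eq_natCast, encodeInt_natCast]
      simp only [Int.ofNat_eq_natCast] at h2
      rw [if_neg (by omega)]
      omega
    | negSucc k =>
      simp only [encodeWithTopInt, encB_coe, encodeInt_negSucc]
      rw [Int.negSucc_eq] at h1 ⊢
      have hk : ((B : ℤ) + -((k : ℤ) + 1)).toNat = B - (k + 1) := by omega
      rw [hk, if_pos (by omega)]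
      omega

/-- Biased words are words. [folklore] -/
theorem encodeOut_lt {B b : ℕ} (hB : 0 < B) (hb : b ≤ 3 * B) : encodeOut B (3 * B) b < 8 * B := by
  unfold encodeOut
  split_ifs <;> omega

variable {n : ℕ} (W : Matrix (Fin n) (Fin n) (WithTop ℤ))

/-- **The relaxation loop computes Floyd's in-place matrices** (in biased words).
[cite: FloydCACM1962, Algorithm 97] -/
theorem relaxSeq_eq_encB (h : HasNoNegativeCycle W) {M : ℕ} (hW : HasBoundedWeights W M)
    {B : ℕ} (hB : 0 < B) (hM : 2 * (n * M) ≤ B) {V : ℕ → ℕ}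
    (hV : ∀ i j : Fin n, V (i * n + j) = encB B (fwInit W i j)) :
    ∀ t ≤ n * n * n, ∀ i j : Fin n,
      relaxSeq n B (3 * B) V t (i * n + j) = encB B (fwInPlace W t i j)
  | 0, _, i, j => by rw [relaxSeq, hV, fwInPlace_zero]
  | t + 1, ht, i, j => by
    have hn : 0 < n := Fin.pos i
    have hN : 0 < n * n := Nat.mul_pos hn hn
    have ht' : t < n * n * n := ht
    have hk : t / (n * n) < n := FloydWarshall.div_sq_lt_of_lt_cube ht'
    set k := t / (n * n) with hkdef
    set p := t % (n * n) with hpdef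
    have hpN : p < n * n := Nat.mod_lt _ hN
    have hi₀ : p / n < n := (Nat.div_lt_iff_lt_mul hn).2 hpN
    have hj₀ : p % n < n := Nat.mod_lt _ hn
    set i₀ : Fin n := ⟨p / n, hi₀⟩
    set j₀ : Fin n := ⟨p % n, hj₀⟩
    set κ : Fin n := ⟨k, hk⟩
    have hp : (i₀ : ℕ) * n + j₀ = p := Nat.div_add_mod' p n
    have IH := relaxSeq_eq_encB h hW hB hM hV t ht'.le
    have hbd := hasBoundedWeights_fwInPlace W h hW t
    rw [relaxSeq]
    by_cases hq : (i : ℕ) * n + j = p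
    · obtain ⟨rfl, rfl⟩ : i = i₀ ∧ j = j₀ := FloydWarshall.flat_injective (hq.trans hp.symm)
      rw [← hpdef, ← hq, Function.update_self, ← hkdef]
      have e1 : ((i₀ : ℕ) * n + j₀) / n * n + k = i₀ * n + κ := by
        rw [hp]
      have e2 : k * n + ((i₀ : ℕ) * n + j₀) % n = (κ : ℕ) * n + j₀ := by
        rw [hp]
      rw [e1, e2, IH, IH, IH, relaxOut_encB hB hM (hbd _ _) (hbd _ _) (hbd _ _),
        fwInPlace_succ_of_eq W h (hq.trans hpdef) hk, min_comm]
    · rw [← hpdef, Function.update_of_ne hq, IH, fwInPlace_succ_of_ne W t (by rwa [← hpdef])]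

/-- Row-major indexing of a `flatMap` over `List.finRange`. [folklore] -/
theorem getElem?_flatMap_finRange {α : Type*} :
    ∀ {m : ℕ} (n : ℕ) (f : Fin m → Fin n → α) (i : Fin m) (j : Fin n),
      ((List.finRange m).flatMap fun i => (List.finRange n).map (f i))[(i : ℕ) * n + j]? =
        some (f i j)
  | 0, _, _, i, _ => i.elim0
  | m + 1, n, f, i, j => by
    rw [List.finRange_succ, List.flatMap_cons]
    cases i using Fin.cases with
    | zero =>
      rw [List.getElem?_append_left (by simp)]
      simp
    | succ i =>
      rw [List.getElem?_append_right (by simp [Nat.succ_mul]; omega), List.flatMap_map]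
      have e : ((Fin.succ i : Fin (m + 1)) : ℕ) * n + j - ((List.finRange n).map (f 0)).length
          = (i : ℕ) * n + j := by
        simp [Nat.succ_mul]; omega
      rw [e]
      exact getElem?_flatMap_finRange n (fun i => f i.succ) i j

/-- The input word holding entry `(i, j)`. [folklore] -/
theorem encodeMatrixWithTop_getElem? (i j : Fin n) :
    (encodeMatrixWithTop W)[(i : ℕ) * n + j + 1]? = some (encodeWithTopInt (W i j)) := by
  rw [encodeMatrixWithTop, List.getElem?_cons_succ, getElem?_flatMap_finRange]

/-- The initial memory holds entry `(i, j)` at cell `i n + j + 2`. [folklore] -/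
theorem init_mem_entry {w : ℕ} (hw : inputWidth (encodeMatrixWithTop W) ≤ w) (i j : Fin n) :
    (init w (encodeMatrixWithTop W)).mem ((i : ℕ) * n + j + 2) = encodeWithTopInt (W i j) := by
  have hlt : (i : ℕ) * n + j + 1 < (encodeMatrixWithTop W).length := by
    rw [encodeMatrixWithTop_length, sq]; have := FloydWarshall.flat_lt i j; omega
  have hx := encodeMatrixWithTop_getElem? W i j
  rw [List.getElem?_eq_getElem hlt, Option.some.injEq] at hx
  rw [init_mem_succ _ _ _ hlt, hx, Nat.mod_eq_of_lt]
  exact lt_of_lt_of_le (lt_two_pow_inputWidth_of_mem _ _ (List.mem_iff_getElem?.2 ⟨_,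
    encodeMatrixWithTop_getElem? W i j⟩)) (Nat.pow_le_pow_right Nat.two_pos hw)

/-- The initial memory holds `n` at cell `1`. [folklore] -/
theorem init_mem_one {w : ℕ} (hw : inputWidth (encodeMatrixWithTop W) ≤ w) :
    (init w (encodeMatrixWithTop W)).mem 1 = n := by
  have hlt : 0 < (encodeMatrixWithTop W).length := by rw [encodeMatrixWithTop_length]; omega
  rw [init_mem_succ _ _ _ hlt]
  simp only [encodeMatrixWithTop, List.getElem_cons_zero]
  exact Nat.mod_eq_of_lt (lt_of_lt_of_le
    (lt_two_pow_inputWidth_of_mem _ _ (by simp [encodeMatrixWithTop]))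
    (Nat.pow_le_pow_right Nat.two_pos hw))

/-- Input codes are below `2 ^ inputWidth`. [folklore] -/
theorem init_mem_lt_two_pow_inputWidth {w : ℕ} (x : List ℕ) (hw : inputWidth x ≤ w) (a : ℕ) :
    (init w x).mem a < 2 ^ inputWidth x := by
  rcases Nat.eq_zero_or_pos a with rfl | ha
  · rw [init_mem_zero_of_inputWidth_le hw]; exact length_lt_two_pow_inputWidth x
  obtain ⟨b, rfl⟩ : ∃ b, a = b + 1 := ⟨a - 1, by omega⟩
  rcases Nat.lt_or_ge b x.length with hb | hb
  · rw [init_mem_succ _ _ _ hb]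
    exact lt_of_le_of_lt (Nat.mod_le _ _) (lt_two_pow_inputWidth_of_mem _ _ (List.getElem_mem hb))
  · rw [init_mem_of_length_lt _ _ _ (by omega)]; exact Nat.two_pow_pos _

end glue

/-! ## The straight-line segments -/

section segments

variable {w : ℕ}

open Operand BinOp

attribute [local simp] rP rN rQ rLIM rT rBASE rB rINF rNN rX rY rZ rS rU rV rA

/-- Every memory is a register file over itself. [folklore] -/
theorem eq_regMem16 (mem : ℕ → ℕ) :
    mem = regMem [mem 0, mem 1, mem 2, mem 3, mem 4, mem 5, mem 6, mem 7, mem 8, mem 9, mem 10,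
      mem 11, mem 12, mem 13, mem 14, mem 15] mem := by
  funext a
  by_cases h : a < 16
  · rw [regMem_apply_lt (by simpa using h)]
    interval_cases a <;> rfl
  · rw [regMem_apply_of_le (by simp; omega)]

/-- One save triple `P := n * n; P := P + (16 + l); [P] := cell (2 + l)` on a plain memory.
[folklore] -/
theorem execOps_saveTriple {n l : ℕ} {mem : ℕ → ℕ} (h1 : mem 1 = n) (h30 : n * n + 30 < 2 ^ w)
    (hl : l < 14) (hv : mem (2 + l) < 2 ^ w) :
    execOps w mem [mk mul (dir rP) (dir rN) (dir rN), mk add (dir rP) (dir rP) (imm (16 + l)),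
        mk add (ind rP) (dir (2 + l)) (imm 0)] =
      Function.update (Function.update mem 0 (n * n + 16 + l)) (n * n + 16 + l) (mem (2 + l)) := by
  have e1 : (n * n) % 2 ^ w = n * n := Nat.mod_eq_of_lt (by omega)
  have e2 : (n * n + (16 + l)) % 2 ^ w = n * n + 16 + l := by
    rw [Nat.mod_eq_of_lt (by omega)]; omega
  have e3 : mem (2 + l) % 2 ^ w = mem (2 + l) := Nat.mod_eq_of_lt hv
  simp [execOp, Operand.read, Operand.write, BinOp.eval, h1, e1, e2, e3]

/-- The memory after `saveOps m`. [folklore] -/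
def saveMem (n : ℕ) (mem : ℕ → ℕ) : ℕ → ℕ → ℕ
  | 0 => mem
  | l + 1 => Function.update (Function.update (saveMem n mem l) 0 (n * n + 16 + l)) (n * n + 16 + l)
      (mem (2 + l))

/-- `saveOps` does not touch cells `1, …, 15`. [folklore] -/
theorem saveMem_apply_of_lt {n : ℕ} {mem : ℕ → ℕ} :
    ∀ (l : ℕ) {a : ℕ}, 1 ≤ a → a < 16 → saveMem n mem l a = mem a
  | 0, _, _, _ => rfl
  | l + 1, a, h1, h16 => by
    rw [saveMem, Function.update_of_ne (by omega), Function.update_of_ne (by omega)]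
    exact saveMem_apply_of_lt l h1 h16

/-- The cells written by `saveOps`. [folklore] -/
theorem saveMem_apply {n : ℕ} {mem : ℕ → ℕ} :
    ∀ (l : ℕ) {a : ℕ}, a ≠ 0 → saveMem n mem l a =
      if n * n + 16 ≤ a ∧ a < n * n + 16 + l then mem (a - (n * n + 16) + 2) else mem a
  | 0, a, _ => by simp [saveMem]
  | l + 1, a, ha => by
    rw [saveMem]
    by_cases h : a = n * n + 16 + l
    · subst h
      rw [Function.update_self, if_pos (by omega)]
      congr 1; omega
    · rw [Function.update_of_ne h, Function.update_of_ne ha, saveMem_apply l ha]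
      split_ifs <;> first | rfl | omega

/-- **Saving the input registers**: the effect of `saveOps m`, `m ≤ 14`. [folklore] -/
theorem execOps_saveOps {n : ℕ} {mem : ℕ → ℕ} (h1 : mem 1 = n) (h30 : n * n + 30 < 2 ^ w)
    (hv : ∀ a, mem a < 2 ^ w) : ∀ {m : ℕ}, m ≤ 14 → execOps w mem (saveOps m) = saveMem n mem m
  | 0, _ => rfl
  | m + 1, hm => by
    have hm' : m < 14 := hm
    have hs1 : saveMem n mem m 1 = n := by rw [saveMem_apply_of_lt m le_rfl (by omega), h1]
    have hs2 : saveMem n mem m (2 + m) = mem (2 + m) := saveMem_apply_of_lt m (by omega) (by omega)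
    rw [saveOps, execOps_append, execOps_saveOps h1 h30 hv hm'.le,
      execOps_saveTriple hs1 h30 hm' (by rw [hs2]; exact hv _), hs2]
    rfl

/-- **Setting up the registers** (`BASE := n² + 16; NN := n²; LIM := n²; Q := 14`). [folklore] -/
theorem execOps_prologueRegs {n : ℕ} {mem : ℕ → ℕ} (h1 : mem 1 = n) (h30 : n * n + 30 < 2 ^ w) :
    execOps w mem prologueRegs =
      Function.update (Function.update (Function.update (Function.update mem 5 (n * n + 16))
        8 (n * n)) 3 (n * n)) 2 14 := by
  have e1 : (n * n) % 2 ^ w = n * n := Nat.mod_eq_of_lt (by omega)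
  have e2 : (n * n + 16) % 2 ^ w = n * n + 16 := Nat.mod_eq_of_lt (by omega)
  have e3 : (14 : ℕ) % 2 ^ w = 14 := Nat.mod_eq_of_lt (by omega)
  simp [prologueRegs, execOp, Operand.read, Operand.write, BinOp.eval, h1, e1, e2, e3]

/-- The memory after the prologue. [folklore] -/
def proMem (n : ℕ) (mem : ℕ → ℕ) : ℕ → ℕ :=
  Function.update (Function.update (Function.update (Function.update (saveMem n mem 14)
    5 (n * n + 16)) 8 (n * n)) 3 (n * n)) 2 14

/-- **The prologue.** [folklore] -/
theorem execOps_prologue {n : ℕ} {mem : ℕ → ℕ} (h1 : mem 1 = n) (h30 : n * n + 30 < 2 ^ w)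
    (hv : ∀ a, mem a < 2 ^ w) :
    execOps w mem (prologueSave ++ prologueRegs) = proMem n mem := by
  rw [execOps_append, prologueSave, execOps_saveOps h1 h30 hv le_rfl,
    execOps_prologueRegs (by rw [saveMem_apply_of_lt 14 le_rfl (by omega), h1]) h30]
  rfl

/-- The registers after the prologue. [folklore] -/
theorem proMem_regs {n : ℕ} (mem : ℕ → ℕ) :
    proMem n mem 1 = mem 1 ∧ proMem n mem 2 = 14 ∧ proMem n mem 3 = n * n ∧
      proMem n mem 5 = n * n + 16 ∧ proMem n mem 8 = n * n := by
  simp [proMem, saveMem_apply_of_lt]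

/-- The heap after the prologue: cells `≥ 16` outside the save area are unchanged. [folklore] -/
theorem proMem_apply_of_le {n : ℕ} (mem : ℕ → ℕ) {a : ℕ} (ha : 16 ≤ a) :
    proMem n mem a = if n * n + 16 ≤ a ∧ a < n * n + 30 then mem (a - (n * n + 16) + 2)
      else mem a := by
  simp only [proMem]
  rw [Function.update_of_ne (by omega), Function.update_of_ne (by omega),
    Function.update_of_ne (by omega), Function.update_of_ne (by omega), saveMem_apply 14 (by omega)]

/-- All values after the prologue are words. [folklore] -/
theorem proMem_lt {n : ℕ} {mem : ℕ → ℕ} (h30 : n * n + 30 < 2 ^ w) (hv : ∀ a, mem a < 2 ^ w)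
    (a : ℕ) : proMem n mem a < 2 ^ w := by
  simp only [proMem, Function.update_apply]
  split_ifs <;> try omega
  by_cases ha : a = 0
  · subst ha
    simp only [saveMem, Function.update_apply]
    split_ifs <;> first | omega | exact hv _
  · rw [saveMem_apply 14 ha]
    split_ifs <;> exact hv _

/-- One restore triple `P := n * n; P := P + (16 + l); cell (2 + l) := [P]` on a plain memory.
[folklore] -/
theorem execOps_restoreTriple {n l : ℕ} {mem : ℕ → ℕ} (h1 : mem 1 = n)
    (h30 : n * n + 30 < 2 ^ w) (hl : l < 14) (hv : mem (n * n + 16 + l) < 2 ^ w) :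
    execOps w mem [mk mul (dir rP) (dir rN) (dir rN), mk add (dir rP) (dir rP) (imm (16 + l)),
        mk add (dir (2 + l)) (ind rP) (imm 0)] =
      Function.update (Function.update mem 0 (n * n + 16 + l)) (2 + l) (mem (n * n + 16 + l)) := by
  have e1 : (n * n) % 2 ^ w = n * n := Nat.mod_eq_of_lt (by omega)
  have e2 : (n * n + (16 + l)) % 2 ^ w = n * n + 16 + l := by
    rw [Nat.mod_eq_of_lt (by omega)]; omega
  have e3 : mem (n * n + 16 + l) % 2 ^ w = mem (n * n + 16 + l) := Nat.mod_eq_of_lt hv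
  simp [execOp, Operand.read, Operand.write, BinOp.eval, h1, e1, e2, e3]

/-- The memory after `restoreOps m`. [folklore] -/
def restoreMem (n : ℕ) (mem : ℕ → ℕ) : ℕ → ℕ → ℕ
  | 0 => mem
  | l + 1 => Function.update (Function.update (restoreMem n mem l) 0 (n * n + 16 + l)) (2 + l)
      (mem (n * n + 16 + l))

/-- `restoreOps` does not touch cell `1` and the cells `≥ 16`. [folklore] -/
theorem restoreMem_apply_of_ne {n : ℕ} {mem : ℕ → ℕ} :
    ∀ {l : ℕ}, l ≤ 14 → ∀ {a : ℕ}, a ≠ 0 → (a = 1 ∨ 16 ≤ a) → restoreMem n mem l a = mem a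
  | 0, _, _, _, _ => rfl
  | l + 1, hl, a, h0, ha => by
    rw [restoreMem, Function.update_of_ne (by omega), Function.update_of_ne (by omega)]
    exact restoreMem_apply_of_ne (by omega) h0 ha

/-- The registers written by `restoreOps`. [folklore] -/
theorem restoreMem_apply_reg {n : ℕ} {mem : ℕ → ℕ} :
    ∀ (l : ℕ) {q : ℕ}, q < l → restoreMem n mem l (2 + q) = mem (n * n + 16 + q)
  | 0, _, h => absurd h (Nat.not_lt_zero _)
  | l + 1, q, hq => by
    rw [restoreMem]
    by_cases h : q = l
    · subst h; rw [Function.update_self]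
    · rw [Function.update_of_ne (by omega), Function.update_of_ne (by omega)]
      exact restoreMem_apply_reg l (by omega)

/-- **Restoring the output registers**: the effect of `restoreOps m`, `m ≤ 14`. [folklore] -/
theorem execOps_restoreOps {n : ℕ} {mem : ℕ → ℕ} (h1 : mem 1 = n) (h30 : n * n + 30 < 2 ^ w)
    (hv : ∀ q < 14, mem (n * n + 16 + q) < 2 ^ w) :
    ∀ {m : ℕ}, m ≤ 14 → execOps w mem (restoreOps m) = restoreMem n mem m
  | 0, _ => rfl
  | m + 1, hm => by
    have hm' : m < 14 := hm
    have hs1 : restoreMem n mem m 1 = n := by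
      rw [restoreMem_apply_of_ne hm'.le one_ne_zero (Or.inl rfl), h1]
    have hs2 : restoreMem n mem m (n * n + 16 + m) = mem (n * n + 16 + m) :=
      restoreMem_apply_of_ne hm'.le (by omega) (Or.inr (by omega))
    rw [restoreOps, execOps_append, execOps_restoreOps h1 h30 hv hm'.le,
      execOps_restoreTriple hs1 h30 hm' (by rw [hs2]; exact hv _ hm'), hs2]
    rfl

/-- The memory after the epilogue. [folklore] -/
def epiMem (n : ℕ) (mem : ℕ → ℕ) : ℕ → ℕ :=
  Function.update (restoreMem n mem 14) 0 (n * n + 1)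

/-- **The epilogue.** [folklore] -/
theorem execOps_epilogue {n : ℕ} {mem : ℕ → ℕ} (h1 : mem 1 = n) (h30 : n * n + 30 < 2 ^ w)
    (hv : ∀ q < 14, mem (n * n + 16 + q) < 2 ^ w) :
    execOps w mem epilogue = epiMem n mem := by
  have hR := execOps_restoreOps (w := w) h1 h30 hv (le_refl 14)
  have hs1 : restoreMem n mem 14 1 = n := by
    rw [restoreMem_apply_of_ne le_rfl one_ne_zero (Or.inl rfl), h1]
  have e1 : (n * n) % 2 ^ w = n * n := Nat.mod_eq_of_lt (by omega)
  have e2 : (n * n + 1) % 2 ^ w = n * n + 1 := Nat.mod_eq_of_lt (by omega)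
  rw [epilogue, execOps_append, hR]
  simp [epilogueLen, execOp, Operand.read, Operand.write, BinOp.eval, hs1, e1, e2, epiMem]

/-- The output registers after the epilogue. [folklore] -/
theorem epiMem_spec {n : ℕ} (mem : ℕ → ℕ) :
    epiMem n mem 0 = n * n + 1 ∧ epiMem n mem 1 = mem 1 ∧
      (∀ q < 14, epiMem n mem (2 + q) = mem (n * n + 16 + q)) ∧
      ∀ a, 16 ≤ a → epiMem n mem a = mem a := by
  refine ⟨by simp [epiMem], ?_, fun q hq => ?_, fun a ha => ?_⟩
  · rw [epiMem, Function.update_of_ne one_ne_zero,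
      restoreMem_apply_of_ne le_rfl one_ne_zero (Or.inl rfl)]
  · rw [epiMem, Function.update_of_ne (by omega), restoreMem_apply_reg 14 hq]
  · rw [epiMem, Function.update_of_ne (by omega),
      restoreMem_apply_of_ne le_rfl (by omega) (Or.inr ha)]

/-- **`setupBias`**: `B := 2 ^ (w - 3)`, `INF := 3 B`, `Q := 0`. [folklore] -/
theorem execOps_setupBias {p0 n q lim tt base r6 r7 nn r9 r10 r11 r12 r13 r14 r15 : ℕ}
    {heap : ℕ → ℕ} {B : ℕ} (hB : 8 * B = 2 ^ w) :
    execOps w (regMem [p0, n, q, lim, tt, base, r6, r7, nn, r9, r10, r11, r12, r13, r14, r15] heap)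
        setupBias =
      regMem [p0, n, 0, lim, tt, base, B, 3 * B, nn, r9, r10, r11, r12, r13, r14, r15] heap := by
  have hB0 : 0 < B := by
    have := Nat.two_pow_pos w; omega
  have e1 : 1 % 2 ^ w = 1 := Nat.mod_eq_of_lt (by omega)
  have e3 : (2 ^ w - 1) / 8 = B - 1 := by
    rw [← hB]
    have : 8 * B - 1 = 7 + 8 * (B - 1) := by omega
    rw [this, Nat.add_mul_div_left _ _ (by norm_num : 0 < 8)]
    norm_num
  have e4 : (B - 1 + 1) % 2 ^ w = B := by rw [Nat.sub_add_cancel hB0, Nat.mod_eq_of_lt (by omega)]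
  have e5 : (B * 3) % 2 ^ w = 3 * B := by rw [Nat.mul_comm, Nat.mod_eq_of_lt (by omega)]
  simp [setupBias, execOp, Operand.read, Operand.write, BinOp.eval, regMem_apply_lt,
    update_regMem_lt, e1, e3, e4, e5]

/-- **`setupCube`**: `LIM := n³`, `Q := 0`. [folklore] -/
theorem execOps_setupCube {p0 n q lim tt base B inf r9 r10 r11 r12 r13 r14 r15 : ℕ}
    {heap : ℕ → ℕ} (hn3 : n * n * n < 2 ^ w) :
    execOps w (regMem [p0, n, q, lim, tt, base, B, inf, n * n, r9, r10, r11, r12, r13, r14, r15]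
        heap) setupCube =
      regMem [p0, n, 0, n * n * n, tt, base, B, inf, n * n, r9, r10, r11, r12, r13, r14, r15]
        heap := by
  have e1 : (n * n * n) % 2 ^ w = n * n * n := Nat.mod_eq_of_lt hn3
  simp [setupCube, execOp, Operand.read, Operand.write, BinOp.eval, regMem_apply_lt,
    update_regMem_lt, e1]

/-- **`setupSquare`**: `LIM := n²`, `Q := 0`. [folklore] -/
theorem execOps_setupSquare {p0 n q lim tt base B inf r9 r10 r11 r12 r13 r14 r15 : ℕ}
    {heap : ℕ → ℕ} (hn2 : n * n < 2 ^ w) :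
    execOps w (regMem [p0, n, q, lim, tt, base, B, inf, n * n, r9, r10, r11, r12, r13, r14, r15]
        heap) setupSquare =
      regMem [p0, n, 0, n * n, tt, base, B, inf, n * n, r9, r10, r11, r12, r13, r14, r15]
        heap := by
  have e1 : (n * n) % 2 ^ w = n * n := Nat.mod_eq_of_lt hn2
  simp [setupSquare, execOp, Operand.read, Operand.write, BinOp.eval, regMem_apply_lt,
    update_regMem_lt, e1]

/-- **`setupCopyDown`**: `Q := 14`. [folklore] -/
theorem execOps_setupCopyDown {p0 n q lim tt base B inf nn r9 r10 r11 r12 r13 r14 r15 : ℕ}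
    {heap : ℕ → ℕ} (h14 : 14 < 2 ^ w) :
    execOps w (regMem [p0, n, q, lim, tt, base, B, inf, nn, r9, r10, r11, r12, r13, r14, r15]
        heap) setupCopyDown =
      regMem [p0, n, 14, lim, tt, base, B, inf, nn, r9, r10, r11, r12, r13, r14, r15] heap := by
  have e1 : (14 : ℕ) % 2 ^ w = 14 := Nat.mod_eq_of_lt h14
  simp [setupCopyDown, execOp, Operand.read, Operand.write, BinOp.eval, update_regMem_lt, e1]

end segments

/-! ## The heaps between the phases -/

section heaps

variable {w : ℕ}

/-- Flat positions: row index. [folklore] -/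
theorem flat_div {n : ℕ} (i j : Fin n) : ((i : ℕ) * n + j) / n = i := by
  have hn : 0 < n := Fin.pos i
  rw [Nat.mul_comm, Nat.mul_add_div hn, Nat.div_eq_of_lt j.isLt, Nat.add_zero]

/-- Flat positions: column index. [folklore] -/
theorem flat_mod {n : ℕ} (i j : Fin n) : ((i : ℕ) * n + j) % n = j := by
  rw [Nat.mul_comm, Nat.mul_add_mod, Nat.mod_eq_of_lt j.isLt]

/-- The heap after the copy-up loop (input codes at `BASE + q`). [folklore] -/
def heap₁ (n : ℕ) (m0 : ℕ → ℕ) : ℕ → ℕ :=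
  heapCU (n * n + 16) (proMem n m0) (n * n - 14)

/-- The decode loop's view of the input: entry `q` is the input word `q + 2`. [folklore] -/
def inE (m0 : ℕ → ℕ) : ℕ → ℕ := fun q => m0 (q + 2)

/-- The heap after the decode loop (`D⁽⁰⁾` in biased words). [folklore] -/
def heap₂ (n B : ℕ) (m0 : ℕ → ℕ) : ℕ → ℕ :=
  heapDec n (n * n + 16) B (inE m0) (heap₁ n m0) (n * n)

/-- The matrix at the start of the relaxation loop, by flat position. [folklore] -/
def inV (n B : ℕ) (m0 : ℕ → ℕ) : ℕ → ℕ := fun q => decodeOut B (m0 (q + 2)) (q / n) (q % n)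

/-- The heap after the relaxation loop (`D⁽ⁿ⁾` in biased words). [folklore] -/
def heap₃ (n B : ℕ) (m0 : ℕ → ℕ) : ℕ → ℕ :=
  heapRel n (n * n + 16) (heap₂ n B m0) (relaxSeq n B (3 * B) (inV n B m0)) (n * n * n)

/-- The heap after the encode loop (output codes at `BASE + q`). [folklore] -/
def heap₄ (n B : ℕ) (m0 : ℕ → ℕ) : ℕ → ℕ :=
  heapEnc (n * n + 16) B (3 * B) (heap₃ n B m0) (n * n)

/-- The heap after the copy-down loop (output codes `q ≥ 14` in place). [folklore] -/
def heap₅ (n B : ℕ) (m0 : ℕ → ℕ) : ℕ → ℕ :=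
  heapCD (n * n + 16) (heap₄ n B m0) (n * n - 14)

variable {n B M : ℕ} (W : Matrix (Fin n) (Fin n) (WithTop ℤ))

/-- After copy-up, the input code of entry `q` sits at `BASE + q`. [folklore] -/
theorem heap₁_apply (m0 : ℕ → ℕ) {q : ℕ} (hq : q < n * n) :
    heap₁ n m0 (n * n + 16 + q) = m0 (q + 2) := by
  simp only [heap₁, heapCU]
  split_ifs with h
  · rw [show n * n + 16 + q - (n * n + 16) + 2 = q + 2 by omega]
    have h16 : 16 ≤ q + 2 := by omega
    rw [proMem_apply_of_le m0 h16, if_neg (by omega)]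
  · rw [proMem_apply_of_le m0 (by omega), if_pos (by omega)]
    congr 1; omega

/-- All cells after copy-up are words. [folklore] -/
theorem heap₁_lt {m0 : ℕ → ℕ} (h30 : n * n + 30 < 2 ^ w) (hv : ∀ a, m0 a < 2 ^ w) (a : ℕ) :
    heap₁ n m0 a < 2 ^ w := by
  simp only [heap₁, heapCU]
  split_ifs <;> exact proMem_lt h30 hv _

/-- After decode, `BASE + q` holds the start matrix. [folklore] -/
theorem heap₂_apply (m0 : ℕ → ℕ) {q : ℕ} (hq : q < n * n) :
    heap₂ n B m0 (n * n + 16 + q) = inV n B m0 q := by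
  simp only [heap₂, heapDec, inE, inV]
  rw [if_pos (by omega), Nat.add_sub_cancel_left]

/-- The start matrix is `D⁽⁰⁾` in biased words. [folklore] -/
theorem inV_flat {m0 : ℕ → ℕ}
    (hm0 : ∀ i j : Fin n, m0 ((i : ℕ) * n + j + 2) = encodeWithTopInt (W i j))
    (hMB : M ≤ B) (hW : HasBoundedWeights W M) (i j : Fin n) :
    inV n B m0 (i * n + j) = encB B (fwInit W i j) := by
  rw [inV, flat_div, flat_mod, hm0, decodeOut_encode hMB hW]

/-- **The relaxation loop's matrices are Floyd's in-place matrices**, hence bounded. [folklore] -/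
theorem relaxSeq_inV (hneg : HasNoNegativeCycle W) (hW : HasBoundedWeights W M) (hB : 0 < B)
    (hMB : 2 * (n * M) ≤ B) {m0 : ℕ → ℕ}
    (hm0 : ∀ i j : Fin n, m0 ((i : ℕ) * n + j + 2) = encodeWithTopInt (W i j))
    {t : ℕ} (ht : t ≤ n * n * n) (i j : Fin n) :
    relaxSeq n B (3 * B) (inV n B m0) t (i * n + j) = encB B (fwInPlace W t i j) := by
  have hn : 0 < n := Fin.pos i
  have hMB' : M ≤ B :=
    le_trans (le_trans (Nat.le_mul_of_pos_left M hn) (Nat.le_mul_of_pos_left _ two_pos)) hMB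
  exact relaxSeq_eq_encB W hneg hW hB hMB (inV_flat W hm0 hMB' hW) t ht i j

/-- Bounds of the relaxation loop's matrices. [folklore] -/
theorem relaxSeq_inV_bounds (hneg : HasNoNegativeCycle W) (hW : HasBoundedWeights W M)
    (hB : 0 < B) (hMB : 2 * (n * M) ≤ B) {m0 : ℕ → ℕ}
    (hm0 : ∀ i j : Fin n, m0 ((i : ℕ) * n + j + 2) = encodeWithTopInt (W i j))
    {t : ℕ} (ht : t ≤ n * n * n) {q : ℕ} (hq : q < n * n) :
    relaxSeq n B (3 * B) (inV n B m0) t q ≤ 3 * B ∧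
      B ≤ 2 * relaxSeq n B (3 * B) (inV n B m0) t q := by
  have hn : 0 < n := Nat.pos_of_ne_zero (by rintro rfl; simp at hq)
  set i : Fin n := ⟨q / n, (Nat.div_lt_iff_lt_mul hn).2 hq⟩
  set j : Fin n := ⟨q % n, Nat.mod_lt _ hn⟩
  have hq' : q = (i : ℕ) * n + j := (Nat.div_add_mod' q n).symm
  rw [hq', relaxSeq_inV W hneg hW hB hMB hm0 ht i j]
  exact encB_bounds hMB (hasBoundedWeights_fwInPlace W hneg hW t i j)

/-- After relaxation, `BASE + q` holds the final matrix. [folklore] -/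
theorem heap₃_apply (m0 : ℕ → ℕ) {q : ℕ} (hq : q < n * n) :
    heap₃ n B m0 (n * n + 16 + q) = relaxSeq n B (3 * B) (inV n B m0) (n * n * n) q := by
  simp only [heap₃, heapRel]
  rw [if_pos (by omega), Nat.add_sub_cancel_left]

/-- All cells after decode are words. [folklore] -/
theorem heap₂_lt {m0 : ℕ → ℕ} (hB8 : 8 * B = 2 ^ w) (h30 : n * n + 30 < 2 ^ w)
    (hv : ∀ a, m0 a < 2 ^ w) (hcode : ∀ a, m0 a ≤ B) (a : ℕ) : heap₂ n B m0 a < 2 ^ w := by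
  simp only [heap₂, heapDec, inE]
  split_ifs
  · have : ∀ e i j, e ≤ B → decodeOut B e i j ≤ 3 * B := by
      intro e i j he
      unfold decodeOut decodeVal
      have : e / 2 * (e % 2) ≤ e / 2 := by
        rcases Nat.mod_two_eq_zero_or_one e with h | h <;> simp [h]
      split_ifs <;> omega
    exact lt_of_le_of_lt (this _ _ _ (hcode _)) (by omega)
  · exact heap₁_lt h30 hv a

/-- All cells after relaxation are words. [folklore] -/
theorem heap₃_lt (hneg : HasNoNegativeCycle W) (hW : HasBoundedWeights W M) (hB : 0 < B)
    (hMB : 2 * (n * M) ≤ B) {m0 : ℕ → ℕ}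
    (hm0 : ∀ i j : Fin n, m0 ((i : ℕ) * n + j + 2) = encodeWithTopInt (W i j))
    (hB8 : 8 * B = 2 ^ w) (h30 : n * n + 30 < 2 ^ w) (hv : ∀ a, m0 a < 2 ^ w)
    (hcode : ∀ a, m0 a ≤ B) (a : ℕ) : heap₃ n B m0 a < 2 ^ w := by
  simp only [heap₃, heapRel]
  split_ifs with h
  · exact lt_of_le_of_lt (relaxSeq_inV_bounds W hneg hW hB hMB hm0 le_rfl (q := a - (n * n + 16))
      (by omega)).1 (by omega)
  · exact heap₂_lt hB8 h30 hv hcode a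

/-- **After encode, `BASE + q` holds the output code of the shortest distance.** [folklore] -/
theorem heap₄_apply (hneg : HasNoNegativeCycle W) (hW : HasBoundedWeights W M) (hB : 0 < B)
    (hMB : 2 * (n * M) ≤ B) {m0 : ℕ → ℕ}
    (hm0 : ∀ i j : Fin n, m0 ((i : ℕ) * n + j + 2) = encodeWithTopInt (W i j)) (i j : Fin n) :
    heap₄ n B m0 (n * n + 16 + (i * n + j)) = encodeWithTopInt (shortestDist W i j) := by
  have hq := FloydWarshall.flat_lt i j
  simp only [heap₄, heapEnc]
  rw [if_pos (by omega), heap₃_apply m0 hq, relaxSeq_inV W hneg hW hB hMB hm0 le_rfl i j,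
    fwInPlace_end, floydWarshall_eq_shortestDist W hneg,
    encodeOut_encB hB hMB]
  rw [← floydWarshall_eq_shortestDist W hneg, ← fwInPlace_end]
  exact hasBoundedWeights_fwInPlace W hneg hW _ i j

/-- All cells after encode are words. [folklore] -/
theorem heap₄_lt (hneg : HasNoNegativeCycle W) (hW : HasBoundedWeights W M) (hB : 0 < B)
    (hMB : 2 * (n * M) ≤ B) {m0 : ℕ → ℕ}
    (hm0 : ∀ i j : Fin n, m0 ((i : ℕ) * n + j + 2) = encodeWithTopInt (W i j))
    (hB8 : 8 * B = 2 ^ w) (h30 : n * n + 30 < 2 ^ w) (hv : ∀ a, m0 a < 2 ^ w)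
    (hcode : ∀ a, m0 a ≤ B) (a : ℕ) : heap₄ n B m0 a < 2 ^ w := by
  simp only [heap₄, heapEnc]
  split_ifs with h
  · have hq : a - (n * n + 16) < n * n := by omega
    have hb := (relaxSeq_inV_bounds W hneg hW hB hMB hm0 le_rfl hq).1
    rw [show a = n * n + 16 + (a - (n * n + 16)) by omega, heap₃_apply m0 hq]
    exact lt_of_lt_of_le (encodeOut_lt hB hb) (by omega)
  · exact heap₃_lt W hneg hW hB hMB hm0 hB8 h30 hv hcode a

/-- After copy-down, the output code of entry `q ≥ 14` sits at cell `q + 2`. [folklore] -/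
theorem heap₅_apply_add_two (m0 : ℕ → ℕ) {q : ℕ} (hq : q < n * n) (h14 : 14 ≤ q) :
    heap₅ n B m0 (q + 2) = heap₄ n B m0 (n * n + 16 + q) := by
  simp only [heap₅, heapCD]
  rw [if_pos (by omega)]
  congr 1; omega

/-- Copy-down does not touch the cells from `BASE` on. [folklore] -/
theorem heap₅_apply_base (m0 : ℕ → ℕ) (q : ℕ) :
    heap₅ n B m0 (n * n + 16 + q) = heap₄ n B m0 (n * n + 16 + q) := by
  simp only [heap₅, heapCD]
  rw [if_neg (by omega)]

/-- All cells after copy-down are words. [folklore] -/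
theorem heap₅_lt {m0 : ℕ → ℕ} (h : ∀ a, heap₄ n B m0 a < 2 ^ w) (a : ℕ) :
    heap₅ n B m0 a < 2 ^ w := by
  simp only [heap₅, heapCD]
  split_ifs <;> exact h _

end heaps

/-! ## The whole run -/

section main

variable {w : ℕ} {O : List ℕ → List ℕ} {ρ : ℕ → ℕ}

attribute [local simp] rP rN rQ rLIM rT rBASE rB rINF rNN rX rY rZ rS rU rV rA

/-- Straight-line segments in anonymous-constructor form. [folklore] -/
theorem run_seg {P : Program} (l : List OpSpec) {p : ℕ} (h : CodeAt P p (ops l))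
    (mem : ℕ → ℕ) (cp : ℕ) (qs : List (List ℕ)) :
    run P w O ρ l.length ⟨some p, mem, cp, qs⟩ =
      some ⟨some (p + l.length), execOps w mem l, cp, qs⟩ :=
  run_ops l h rfl

/-- The number of steps of `apspProgram` on an `n`-vertex instance (prologue; the five loops
with their set-ups and exits; epilogue; `halt`). [folklore] -/
def apspSteps (n : ℕ) : ℕ :=
  47 + ((n * n - 14) * 7 + 2) + 5 + (n * n * 25 + 2) + 2 + (n * n * n * 32 + 2) + 2 +
    (n * n * 20 + 2) + 1 + ((n * n - 14) * 7 + 2) + 44 + 1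

/-- A cubic bound on the number of steps. [folklore] -/
theorem apspSteps_le (n : ℕ) : apspSteps n ≤ 32 * (n * n * n) + 59 * (n * n) + 112 := by
  unfold apspSteps; omega

/-- The prologue has `47` operations. [folklore] -/
theorem prologue_length : (prologueSave ++ prologueRegs).length = 47 := rfl
/-- The epilogue has `44` operations. [folklore] -/
theorem epilogue_length : epilogue.length = 44 := rfl

/-- **Floyd's Algorithm 97 on the word RAM: the run.** On the encoding of an `n`-vertex weight
matrix `W` without negative cycles and with weights in `[-M, M]`, with a word size `w` exceeding
the input width by three bits and large enough to hold `16 n M`, `2 n² + 32` and `n³`, the program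
halts after exactly `apspSteps n` steps with output `encodeMatrixWithTop (shortestDist W)`.
[cite: FloydCACM1962, Algorithm 97] -/
theorem apsp_run {n : ℕ} (W : Matrix (Fin n) (Fin n) (WithTop ℤ)) (hneg : HasNoNegativeCycle W)
    {M : ℕ} (hW : HasBoundedWeights W M) (hwid : inputWidth (encodeMatrixWithTop W) + 3 ≤ w)
    (hM : 16 * (n * M) ≤ 2 ^ w) (hsq : 2 * (n * n) + 32 ≤ 2 ^ w) (hn3 : n * n * n < 2 ^ w) :
    ∃ mem : ℕ → ℕ, run apspProgram w O ρ (apspSteps n) (init w (encodeMatrixWithTop W)) =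
      some ⟨none, mem, 0, []⟩ ∧ readOut mem = encodeMatrixWithTop (shortestDist W) := by
  -- the bias
  have hwpos := inputWidth_pos (encodeMatrixWithTop W)
  set B := 2 ^ (w - 3) with hBdef
  have hB8 : 8 * B = 2 ^ w := by
    rw [hBdef, show (8 : ℕ) = 2 ^ 3 by norm_num, ← pow_add, show 3 + (w - 3) = w by omega]
  have hB0 : 0 < B := Nat.two_pow_pos _
  have hMB : 2 * (n * M) ≤ B := by omega
  -- the input
  set x := encodeMatrixWithTop W with hxdef
  have hwle : inputWidth x ≤ w := by omega
  set m0 := (init w x).mem with hm0def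
  have hm1 : m0 1 = n := init_mem_one W hwle
  have hm0w : ∀ a, m0 a < 2 ^ inputWidth x := init_mem_lt_two_pow_inputWidth x hwle
  have hv : ∀ a, m0 a < 2 ^ w := fun a =>
    lt_of_lt_of_le (hm0w a) (Nat.pow_le_pow_right Nat.two_pos hwle)
  have hcode : ∀ a, m0 a ≤ B := fun a =>
    (lt_of_lt_of_le (hm0w a) (Nat.pow_le_pow_right Nat.two_pos (by omega))).le
  have hent : ∀ i j : Fin n, m0 ((i : ℕ) * n + j + 2) = encodeWithTopInt (W i j) :=
    init_mem_entry W hwle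
  have h30 : n * n + 30 < 2 ^ w := by omega
  have haddr : n * n + 16 + n * n < 2 ^ w := by omega
  have h16 : 16 ≤ n * n + 16 := by omega
  -- phase 0: the prologue
  obtain ⟨hr1, hr2, hr3, hr5, hr8⟩ := proMem_regs (n := n) m0
  rw [hm1] at hr1
  set P0 := proMem n m0 with hP0def
  have hpro : P0 = regMem [P0 0, n, 14, n * n, P0 4, n * n + 16, P0 6, P0 7, n * n, P0 9, P0 10,
      P0 11, P0 12, P0 13, P0 14, P0 15] P0 := by
    conv_lhs => rw [eq_regMem16 P0]
    rw [hr1, hr2, hr3, hr5, hr8]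
  have r0 : run apspProgram w O ρ 47 ⟨some 0, m0, 0, []⟩ =
      some ⟨some L1, regMem [P0 0, n, 14, n * n, P0 4, n * n + 16, P0 6, P0 7, n * n, P0 9, P0 10,
        P0 11, P0 12, P0 13, P0 14, P0 15] P0, 0, []⟩ := by
    rw [← hpro]
    have h := run_seg (w := w) (O := O) (ρ := ρ) (prologueSave ++ prologueRegs) code_prologue m0 0
      []
    rwa [prologue_length, execOps_prologue hm1 h30 hv, Nat.zero_add] at h
  -- phase 1: copy-up
  have cu := copyUp_phase (w := w) (p0 := P0 0) (r4 := P0 4) (r6 := P0 6) (r7 := P0 7)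
    (r9 := P0 9) (r10 := P0 10) (r11 := P0 11) (r12 := P0 12) (r13 := P0 13) (r14 := P0 14)
    (r15 := P0 15) (heap := P0) (n := n) rfl haddr (proMem_lt h30 hv)
  obtain ⟨a4, a9, a10, a11, a12, a13, a14, a15, hK1⟩ := cu (n * n - 14) le_rfl
  have r1 : run apspProgram w O ρ ((n * n - 14) * 7 + 2)
      ⟨some L1, regMem [P0 0, n, 14, n * n, P0 4, n * n + 16, P0 6, P0 7, n * n, P0 9, P0 10,
        P0 11, P0 12, P0 13, P0 14, P0 15] P0, 0, []⟩ =
      some ⟨some E1, regMem [P0 0, n, 14 + (n * n - 14), n * n, 0, n * n + 16, P0 6, P0 7, n * n,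
        a9, a10, a11, a12, a13, a14, a15] (heap₁ n m0), 0, []⟩ := by
    have h := run_forLoop_exit_of_iterate (w := w) (O := O) (ρ := ρ) code_loop1 0 [] (n * n - 14)
      (regMem [P0 0, n, 14, n * n, P0 4, n * n + 16, P0 6, P0 7, n * n, P0 9, P0 10, P0 11, P0 12,
        P0 13, P0 14, P0 15] P0)
      (fun t ht => by
        obtain ⟨b4, b9, b10, b11, b12, b13, b14, b15, h⟩ := cu t ht.le
        rw [h, regMem_apply_lt (by simp), regMem_apply_lt (by simp)]
        simp; omega)
      (by rw [hK1, regMem_apply_lt (by simp), regMem_apply_lt (by simp)]; simp; omega)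
    rw [hK1, update_regMem_lt (by simp), show copyUpBody.length + 4 = 7 from rfl,
      show heapCU (n * n + 16) P0 (n * n - 14) = heap₁ n m0 from rfl] at h
    simpa using h
  -- phase 2: set up the bias, decode
  have r2a : run apspProgram w O ρ 5
      ⟨some E1, regMem [P0 0, n, 14 + (n * n - 14), n * n, 0, n * n + 16, P0 6, P0 7, n * n,
        a9, a10, a11, a12, a13, a14, a15] (heap₁ n m0), 0, []⟩ =
      some ⟨some L2, regMem [P0 0, n, 0, n * n, 0, n * n + 16, B, 3 * B, n * n,
        a9, a10, a11, a12, a13, a14, a15] (heap₁ n m0), 0, []⟩ := by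
    have h := run_seg (w := w) (O := O) (ρ := ρ) setupBias code_setupBias
      (regMem [P0 0, n, 14 + (n * n - 14), n * n, 0, n * n + 16, P0 6, P0 7, n * n,
        a9, a10, a11, a12, a13, a14, a15] (heap₁ n m0)) 0 []
    rwa [execOps_setupBias hB8] at h
  have de := decode_phase (w := w) (p0 := P0 0) (n := n) (base := n * n + 16) (B := B)
    (inf := 3 * B) (r4 := 0) (r9 := a9) (r10 := a10) (r11 := a11) (r12 := a12) (r13 := a13)
    (r14 := a14) (r15 := a15) (E := inE m0) (heap := heap₁ n m0) h16 haddr hB8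
    (fun q _ => hcode _) (fun q hq => heap₁_apply m0 hq)
  obtain ⟨b4, b9, b10, b11, b12, b13, b14, b15, hK2⟩ := de (n * n) le_rfl
  have r2 : run apspProgram w O ρ (n * n * 25 + 2)
      ⟨some L2, regMem [P0 0, n, 0, n * n, 0, n * n + 16, B, 3 * B, n * n,
        a9, a10, a11, a12, a13, a14, a15] (heap₁ n m0), 0, []⟩ =
      some ⟨some E2, regMem [P0 0, n, n * n, n * n, 0, n * n + 16, B, 3 * B, n * n,
        b9, b10, b11, b12, b13, b14, b15] (heap₂ n B m0), 0, []⟩ := by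
    have h := run_forLoop_exit_of_iterate (w := w) (O := O) (ρ := ρ) code_loop2 0 [] (n * n)
      (regMem [P0 0, n, 0, n * n, 0, n * n + 16, B, 3 * B, n * n, a9, a10, a11, a12, a13, a14,
        a15] (heap₁ n m0))
      (fun t ht => by
        obtain ⟨c4, c9, c10, c11, c12, c13, c14, c15, h⟩ := de t ht.le
        rw [h, regMem_apply_lt (by simp), regMem_apply_lt (by simp)]
        simpa using ht)
      (by rw [hK2, regMem_apply_lt (by simp), regMem_apply_lt (by simp)]; simp)
    rw [hK2, update_regMem_lt (by simp), show decodeBody.length + 4 = 25 from rfl,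
      show heapDec n (n * n + 16) B (inE m0) (heap₁ n m0) (n * n) = heap₂ n B m0 from rfl] at h
    simpa using h
  -- phase 3: set up the cube, relax
  have r3a : run apspProgram w O ρ 2
      ⟨some E2, regMem [P0 0, n, n * n, n * n, 0, n * n + 16, B, 3 * B, n * n,
        b9, b10, b11, b12, b13, b14, b15] (heap₂ n B m0), 0, []⟩ =
      some ⟨some L3, regMem [P0 0, n, 0, n * n * n, 0, n * n + 16, B, 3 * B, n * n,
        b9, b10, b11, b12, b13, b14, b15] (heap₂ n B m0), 0, []⟩ := by
    have h := run_seg (w := w) (O := O) (ρ := ρ) setupCube code_setupCube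
      (regMem [P0 0, n, n * n, n * n, 0, n * n + 16, B, 3 * B, n * n,
        b9, b10, b11, b12, b13, b14, b15] (heap₂ n B m0)) 0 []
    rwa [execOps_setupCube hn3] at h
  have re := relax_phase (w := w) (p0 := P0 0) (n := n) (base := n * n + 16) (B := B)
    (inf := 3 * B) (r4 := 0) (r9 := b9) (r10 := b10) (r11 := b11) (r12 := b12) (r13 := b13)
    (r14 := b14) (r15 := b15) (V := inV n B m0) (heap := heap₂ n B m0) h16 haddr hn3 hB8 rfl
    (fun t ht q hq => relaxSeq_inV_bounds W hneg hW hB0 hMB hent ht hq)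
    (fun q hq => heap₂_apply m0 hq)
  obtain ⟨c4, c9, c10, c11, c12, c13, c14, c15, hK3⟩ := re (n * n * n) le_rfl
  have r3 : run apspProgram w O ρ (n * n * n * 32 + 2)
      ⟨some L3, regMem [P0 0, n, 0, n * n * n, 0, n * n + 16, B, 3 * B, n * n,
        b9, b10, b11, b12, b13, b14, b15] (heap₂ n B m0), 0, []⟩ =
      some ⟨some E3, regMem [P0 0, n, n * n * n, n * n * n, 0, n * n + 16, B, 3 * B, n * n,
        c9, c10, c11, c12, c13, c14, c15] (heap₃ n B m0), 0, []⟩ := by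
    have h := run_forLoop_exit_of_iterate (w := w) (O := O) (ρ := ρ) code_loop3 0 []
      (n * n * n)
      (regMem [P0 0, n, 0, n * n * n, 0, n * n + 16, B, 3 * B, n * n, b9, b10, b11, b12, b13,
        b14, b15] (heap₂ n B m0))
      (fun t ht => by
        obtain ⟨d4, d9, d10, d11, d12, d13, d14, d15, h⟩ := re t ht.le
        rw [h, regMem_apply_lt (by simp), regMem_apply_lt (by simp)]
        simpa using ht)
      (by rw [hK3, regMem_apply_lt (by simp), regMem_apply_lt (by simp)]; simp)
    rw [hK3, update_regMem_lt (by simp), show relaxBody.length + 4 = 32 from rfl,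
      show heapRel n (n * n + 16) (heap₂ n B m0) (relaxSeq n B (3 * B) (inV n B m0))
        (n * n * n) = heap₃ n B m0 from rfl] at h
    simpa using h
  -- phase 4: set up the square, encode
  have r4a : run apspProgram w O ρ 2
      ⟨some E3, regMem [P0 0, n, n * n * n, n * n * n, 0, n * n + 16, B, 3 * B, n * n,
        c9, c10, c11, c12, c13, c14, c15] (heap₃ n B m0), 0, []⟩ =
      some ⟨some L4, regMem [P0 0, n, 0, n * n, 0, n * n + 16, B, 3 * B, n * n,
        c9, c10, c11, c12, c13, c14, c15] (heap₃ n B m0), 0, []⟩ := by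
    have h := run_seg (w := w) (O := O) (ρ := ρ) setupSquare code_setupSquare
      (regMem [P0 0, n, n * n * n, n * n * n, 0, n * n + 16, B, 3 * B, n * n,
        c9, c10, c11, c12, c13, c14, c15] (heap₃ n B m0)) 0 []
    rwa [execOps_setupSquare (by omega)] at h
  have en := encode_phase (w := w) (p0 := P0 0) (n := n) (base := n * n + 16) (B := B)
    (inf := 3 * B) (r4 := 0) (r9 := c9) (r10 := c10) (r11 := c11) (r12 := c12) (r13 := c13)
    (r14 := c14) (r15 := c15) (heap := heap₃ n B m0) h16 haddr hB8 rfl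
    (fun q hq => by
      rw [heap₃_apply m0 hq]
      exact (relaxSeq_inV_bounds W hneg hW hB0 hMB hent le_rfl hq).1)
  obtain ⟨d4, d9, d10, d11, d12, d13, d14, d15, hK4⟩ := en (n * n) le_rfl
  have r4 : run apspProgram w O ρ (n * n * 20 + 2)
      ⟨some L4, regMem [P0 0, n, 0, n * n, 0, n * n + 16, B, 3 * B, n * n,
        c9, c10, c11, c12, c13, c14, c15] (heap₃ n B m0), 0, []⟩ =
      some ⟨some E4, regMem [P0 0, n, n * n, n * n, 0, n * n + 16, B, 3 * B, n * n,
        d9, d10, d11, d12, d13, d14, d15] (heap₄ n B m0), 0, []⟩ := by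
    have h := run_forLoop_exit_of_iterate (w := w) (O := O) (ρ := ρ) code_loop4 0 [] (n * n)
      (regMem [P0 0, n, 0, n * n, 0, n * n + 16, B, 3 * B, n * n, c9, c10, c11, c12, c13, c14,
        c15] (heap₃ n B m0))
      (fun t ht => by
        obtain ⟨e4, e9, e10, e11, e12, e13, e14, e15, h⟩ := en t ht.le
        rw [h, regMem_apply_lt (by simp), regMem_apply_lt (by simp)]
        simpa using ht)
      (by rw [hK4, regMem_apply_lt (by simp), regMem_apply_lt (by simp)]; simp)
    rw [hK4, update_regMem_lt (by simp), show encodeBody.length + 4 = 20 from rfl,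
      show heapEnc (n * n + 16) B (3 * B) (heap₃ n B m0) (n * n) = heap₄ n B m0 from rfl] at h
    simpa using h
  -- phase 5: copy down
  have r5a : run apspProgram w O ρ 1
      ⟨some E4, regMem [P0 0, n, n * n, n * n, 0, n * n + 16, B, 3 * B, n * n,
        d9, d10, d11, d12, d13, d14, d15] (heap₄ n B m0), 0, []⟩ =
      some ⟨some L5, regMem [P0 0, n, 14, n * n, 0, n * n + 16, B, 3 * B, n * n,
        d9, d10, d11, d12, d13, d14, d15] (heap₄ n B m0), 0, []⟩ := by
    have h := run_seg (w := w) (O := O) (ρ := ρ) setupCopyDown code_setupCopyDown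
      (regMem [P0 0, n, n * n, n * n, 0, n * n + 16, B, 3 * B, n * n,
        d9, d10, d11, d12, d13, d14, d15] (heap₄ n B m0)) 0 []
    rwa [execOps_setupCopyDown (by omega)] at h
  have h4lt : ∀ a, heap₄ n B m0 a < 2 ^ w := heap₄_lt W hneg hW hB0 hMB hent hB8 h30 hv hcode
  have cd := copyDown_phase (w := w) (p0 := P0 0) (n := n) (base := n * n + 16) (r4 := 0)
    (r6 := B) (r7 := 3 * B) (r9 := d9) (r10 := d10) (r11 := d11) (r12 := d12) (r13 := d13)
    (r14 := d14) (r15 := d15) (heap := heap₄ n B m0) rfl haddr (fun q _ => h4lt _)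
  obtain ⟨e4, e9, e10, e11, e12, e13, e14, e15, hK5⟩ := cd (n * n - 14) le_rfl
  have r5 : run apspProgram w O ρ ((n * n - 14) * 7 + 2)
      ⟨some L5, regMem [P0 0, n, 14, n * n, 0, n * n + 16, B, 3 * B, n * n,
        d9, d10, d11, d12, d13, d14, d15] (heap₄ n B m0), 0, []⟩ =
      some ⟨some E5, regMem [P0 0, n, 14 + (n * n - 14), n * n, 0, n * n + 16, B, 3 * B, n * n,
        e9, e10, e11, e12, e13, e14, e15] (heap₅ n B m0), 0, []⟩ := by
    have h := run_forLoop_exit_of_iterate (w := w) (O := O) (ρ := ρ) code_loop5 0 [] (n * n - 14)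
      (regMem [P0 0, n, 14, n * n, 0, n * n + 16, B, 3 * B, n * n, d9, d10, d11, d12, d13, d14,
        d15] (heap₄ n B m0))
      (fun t ht => by
        obtain ⟨f4, f9, f10, f11, f12, f13, f14, f15, h⟩ := cd t ht.le
        rw [h, regMem_apply_lt (by simp), regMem_apply_lt (by simp)]
        simp; omega)
      (by rw [hK5, regMem_apply_lt (by simp), regMem_apply_lt (by simp)]; simp; omega)
    rw [hK5, update_regMem_lt (by simp), show copyDownBody.length + 4 = 7 from rfl,
      show heapCD (n * n + 16) (heap₄ n B m0) (n * n - 14) = heap₅ n B m0 from rfl] at h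
    simpa using h
  -- phase 6: the epilogue and `halt`
  set ME := regMem [P0 0, n, 14 + (n * n - 14), n * n, 0, n * n + 16, B, 3 * B, n * n,
        e9, e10, e11, e12, e13, e14, e15] (heap₅ n B m0) with hME
  have hME1 : ME 1 = n := by rw [hME, regMem_apply_lt (by simp)]; simp
  have hMEb : ∀ q, ME (n * n + 16 + q) = heap₄ n B m0 (n * n + 16 + q) := fun q => by
    rw [hME, regMem_apply_of_le (by simp; omega), heap₅_apply_base]
  have r6 : run apspProgram w O ρ 44 ⟨some E5, ME, 0, []⟩ =
      some ⟨some HALT, epiMem n ME, 0, []⟩ := by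
    have h := run_seg (w := w) (O := O) (ρ := ρ) epilogue code_epilogue ME 0 []
    rwa [epilogue_length, execOps_epilogue hME1 h30 (fun q _ => by rw [hMEb]; exact h4lt _)] at h
  have r7 : run apspProgram w O ρ 1 ⟨some HALT, epiMem n ME, 0, []⟩ =
      some ⟨none, epiMem n ME, 0, []⟩ := by
    rw [run_one, step_halt (c := ⟨some HALT, epiMem n ME, 0, []⟩) rfl code_halt]
  -- the whole run
  refine ⟨epiMem n ME, ?_, ?_⟩
  · exact run_add_of_run _ _ _ _ (run_add_of_run _ _ _ _ (run_add_of_run _ _ _ _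
      (run_add_of_run _ _ _ _ (run_add_of_run _ _ _ _ (run_add_of_run _ _ _ _
      (run_add_of_run _ _ _ _ (run_add_of_run _ _ _ _ (run_add_of_run _ _ _ _
      (run_add_of_run _ _ _ _ (run_add_of_run _ _ _ _ r0 r1) r2a) r2) r3a) r3) r4a) r4) r5a)
      r5) r6) r7
  -- the output
  · obtain ⟨hE0, hE1, hEreg, hEhi⟩ := epiMem_spec (n := n) ME
    have hout : ∀ i j : Fin n,
        epiMem n ME ((i : ℕ) * n + j + 2) = encodeWithTopInt (shortestDist W i j) := by
      intro i j
      have hq := FloydWarshall.flat_lt i j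
      have key : heap₄ n B m0 (n * n + 16 + (i * n + j)) = encodeWithTopInt (shortestDist W i j) :=
        heap₄_apply W hneg hW hB0 hMB hent i j
      rcases Nat.lt_or_ge ((i : ℕ) * n + j) 14 with h14 | h14
      · rw [Nat.add_comm, hEreg _ h14, hMEb, key]
      · rw [Nat.add_comm, hEhi _ (by omega), hME, regMem_apply_of_le (by simp; omega),
          Nat.add_comm, heap₅_apply_add_two m0 hq h14, key]
    apply List.ext_getElem
    · rw [readOut_length, hE0, encodeMatrixWithTop_length, sq]
    · intro k hk1 hk2
      rw [readOut_length, hE0] at hk1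
      simp only [readOut, readSeg, List.getElem_map, List.getElem_range, hE0]
      cases k with
      | zero => rw [hE1, hME1]; simp [encodeMatrixWithTop]
      | succ q =>
        have hq : q < n * n := by omega
        have hn : 0 < n := Nat.pos_of_ne_zero (by rintro rfl; simp at hq)
        set i : Fin n := ⟨q / n, (Nat.div_lt_iff_lt_mul hn).2 hq⟩ with hi
        set j : Fin n := ⟨q % n, Nat.mod_lt _ hn⟩ with hj
        have hq' : q = (i : ℕ) * n + j := (Nat.div_add_mod' q n).symm
        have hget := encodeMatrixWithTop_getElem? (shortestDist W) i j
        rw [← hq', List.getElem?_eq_getElem hk2, Option.some.injEq] at hget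
        rw [show 1 + (q + 1) = (i : ℕ) * n + j + 2 by omega, hout i j]
        exact hget.symm

end main

end APSPProg

end Literature.Computability.Cryptography.WordRAM

/-! ## `APSP c ∈ TIME(O(n³))`: discharge of the named fact `APSP_inTimeO_cube` -/

namespace Literature.Computability.Cryptography

open WordRAM WordRAM.APSPProg

/-- **Floyd–Warshall: `APSP c ∈ TIME(O(n³))` on the word RAM** (discharges the named fact
`APSP_inTimeO_cube` of `…FGProblemZoo`): with `C = 203` and word-size constant `k = c + 7`, the
program `apspProgram` outputs `encodeMatrixWithTop (shortestDist W)` within `C n³ + C` steps on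
every instance of `APSP c` (`apsp_run`). R. W. Floyd, Algorithm 97 (1962); CLRS §25.2
(`FLOYD-WARSHALL` runs in `Θ(n³)`). [cite: FloydCACM1962, Algorithm 97]
[cite: CLRS2009, §25.2 (Floyd–Warshall, Θ(n³))] -/
theorem APSP_inTimeO_cube_holds : APSP_inTimeO_cube := by
  intro c
  refine ⟨203, apspProgram, c + 7, isDeterministic, isOracleFree, ?_⟩
  rintro ⟨⟨n, W⟩, hW, hneg⟩
  refine ⟨encodeMatrixWithTop (shortestDist W), by simp, ?_⟩
  show OutputsWithin apspProgram ((c + 7) * inputWidth (encodeMatrixWithTop W)) noOracle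
    zeroCoins (encodeMatrixWithTop W) (encodeMatrixWithTop (shortestDist W))
    ⌊(203 : ℝ) * (n : ℝ) ^ 3 + 203⌋₊
  -- the word size
  set wd := inputWidth (encodeMatrixWithTop W) with hwd
  have hwd0 : 0 < wd := inputWidth_pos _
  have hN : n * n + 2 ≤ 2 ^ wd := by
    have h := length_lt_two_pow_inputWidth (encodeMatrixWithTop W)
    rw [encodeMatrixWithTop_length, sq] at h
    exact h
  have hn : n < 2 ^ wd := lt_of_le_of_lt (by nlinarith) (show n * n + 1 < 2 ^ wd by omega)
  have hpow : ∀ {a b : ℕ}, a ≤ b → 2 ^ a ≤ 2 ^ b := fun h => Nat.pow_le_pow_right Nat.two_pos h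
  have hw : (c + 7) * wd = c * wd + 7 * wd := by ring
  have hwid : wd + 3 ≤ (c + 7) * wd := by rw [hw]; omega
  have hM : 16 * (n * n ^ c) ≤ 2 ^ ((c + 7) * wd) := by
    have h1 : n ^ (c + 1) ≤ 2 ^ (wd * (c + 1)) := by
      rw [pow_mul]; exact Nat.pow_le_pow_left hn.le _
    have h2 : 16 ≤ 2 ^ (4 * wd) := le_trans (by norm_num : 16 ≤ 2 ^ 4) (hpow (by omega))
    calc 16 * (n * n ^ c) = 16 * n ^ (c + 1) := by ring
      _ ≤ 2 ^ (4 * wd) * 2 ^ (wd * (c + 1)) := Nat.mul_le_mul h2 h1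
      _ = 2 ^ (4 * wd + wd * (c + 1)) := (pow_add _ _ _).symm
      _ ≤ 2 ^ ((c + 7) * wd) := hpow (by rw [hw]; nlinarith)
  have hsq : 2 * (n * n) + 32 ≤ 2 ^ ((c + 7) * wd) :=
    calc 2 * (n * n) + 32 ≤ 16 * (n * n + 2) := by omega
      _ ≤ 2 ^ 4 * 2 ^ wd := Nat.mul_le_mul (by norm_num) hN
      _ = 2 ^ (4 + wd) := (pow_add _ _ _).symm
      _ ≤ 2 ^ ((c + 7) * wd) := hpow (by rw [hw]; omega)
  have hn3 : n * n * n < 2 ^ ((c + 7) * wd) :=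
    calc n * n * n = n ^ 3 := by ring
      _ < (2 ^ wd) ^ 3 := Nat.pow_lt_pow_left hn (by norm_num)
      _ = 2 ^ (wd * 3) := (pow_mul _ _ _).symm
      _ ≤ 2 ^ ((c + 7) * wd) := hpow (by rw [hw]; omega)
  -- the run
  obtain ⟨mem, hrun, hout⟩ := apsp_run (w := (c + 7) * wd) (O := noOracle) (ρ := zeroCoins) W
    hneg hW hwid hM hsq hn3
  have hT : apspSteps n ≤ ⌊(203 : ℝ) * (n : ℝ) ^ 3 + 203⌋₊ := by
    rw [show (203 : ℝ) * (n : ℝ) ^ 3 + 203 = ((203 * n ^ 3 + 203 : ℕ) : ℝ) by push_cast; ring,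
      Nat.floor_natCast]
    refine le_trans (apspSteps_le n) ?_
    rcases Nat.eq_zero_or_pos n with rfl | hn0
    · norm_num
    · have : n * n ≤ n * n * n := Nat.le_mul_of_pos_right _ hn0
      nlinarith
  have h := outputsWithin_of_run hrun (step_of_pc_eq_none (c := ⟨none, mem, 0, []⟩) rfl) hT
  rwa [hout] at h

end Literature.Computability.Cryptography
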